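import Literature.NumberTheory.Sieve.LiouvillePolynomialValuesReducibleProofs
import Literature.NumberTheory.Sieve.LiouvillePolynomialValuesSmoothProofs
import Literature.NumberTheory.Sieve.IwaniecAlmostPrimesQuadraticProp2
import Literature.NumberTheory.Sieve.PolynomialCongruencesLemmas
import Literature.NumberTheory.LFunctions.DegreeOnePrimesPNT
import HarnessLib

/-!
# Property S from a level of distribution — what exactly remains of Teräväinen 2024, Prop. 2.11 (PROVED reductions)

Fourth sibling proof file (theorems only) of `LiouvillePolynomialValues.lean`; namespace
`Literature.NumberTheory.Sieve.PropertyS`.  Source: J. Teräväinen, *On the Liouville function at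
polynomial arguments*, Amer. J. Math. 146 (2024) = arXiv:2010.07924, Proposition 2.11 (quadratic
clause) = the named fact `Literature.NumberTheory.Sieve.teravainen2024_prop_2_11_quadratic`.

The two earlier proof files settle the reducible quadratics
(`hasPropertyS_of_isRoot_rat`, `teravainen2024_prop_2_11_quadratic_of_irreducible`) and the
instance `P = X² + 1`, `q = 1` (`sq_add_one_smooth_pos_density`).  This file runs the argument of
the latter for a GENERAL quadratic `G` irreducible over `ℚ`, with its one deep input — a level of
distribution beyond `x` for the roots of `G (mod d)` — as an explicit hypothesis, and reduces
the named fact to that hypothesis: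

* `exists_const_of_level` — for every `θ > 0` there is `c(θ) > 0` such that every quadratic `G`
  irreducible over `ℚ` with the Iwaniec-type bilinear level of distribution
  `∑_{m < x^{1−4ε}} |∑_{n < x^{θ−ε}, (n,m)=1} b_n (N_G(x; mn) − ρ_G(mn) x/(mn))| ≤ C_ε x^{1−ε}`
  (all `ε > 0`, uniformly in `|b| ≤ 1` supported on squarefrees; `N_G(x; d) = #{t ≤ x : d ∣ G(t)}`,
  `ρ_G = polyRootCountMod ![G]`) has `G(t)` `t`-smooth for `≥ c(θ) y` integers `y < t ≤ 2y`
  (`y` large).  Ingredients, all PROVED: the pair mechanism and multiplicity bound of the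
  `X² + 1` file in integer form (`prime_dvd_cases`, `card_pairs_dvd_le'`,
  `sum_sum_card_window_le_smooth`); the bilinear bound with prime-indicator coefficients
  (`abs_sum_sum_le_of_bilinear`, `sum_sum_card_window_ge_of_level`); multiplicativity of `ρ_G`
  (`polyRootCountMod_mul_of_coprime`, Hooley's Lemma 1); and **Mertens' theorem for `ρ_G` on
  ranges of primes** (`exists_sum_range_polyRootCountMod_div_ge`) from the tree's prime ideal
  theorem in Mertens form for monic irreducible polynomials
  (`DegreeOnePrimes.sum_primesLE_rootCount_div_eq`) via the monic model `Y² + bY + ac` of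
  `aY² + bY + c` (`polyRootCountMod_eq_monicModel`, `irreducible_monicModel`).  The constant
  `c(θ)` depends on `θ` alone — this is the uniformity behind `η₀/q`.
* `exists_const_forall_large_of_level` — the same for all large `X` (`y = X/2`): the `q = 1`
  conditional form of property S for `G`;
* `hasPropertyS_of_level` — if every `P(qX + b)` (`q, b ≥ 1`) has the level of distribution with
  one `θ`, then `P` has property S (`t ↦ qt + b` injects the `t`-smooth values of `P(qt + b)`,
  `y < t ≤ 2y = (x − b)/q`, into the progression count; `η₀ = c(θ)/4`).
* `level_X_sq_add_one` — the hypothesis for `G = X² + 1`, `θ = 1/15` IS Iwaniec's Corollary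
  (`Iwaniec1978.proposition1_corollary_holds`): the hypothesis has the right shape.
* `teravainen2024_prop_2_11_quadratic_of_level` — **the named fact follows from a uniform-`θ`
  level of distribution for all quadratics irreducible over `ℚ` with positive leading
  coefficient** (reducible ones being done); and, in the tree's own vocabulary,
  `teravainen2024_prop_2_11_quadratic_of_proposition1G_corollary` — **the named fact follows from
  `Iwaniec1978.proposition1G_corollary a b c` for all `a > 0` with `aX² + bX + c` irreducible
  over `ℚ`** (`θ = 1/15`; `level_of_proposition1G_corollary` is the dictionary).

So the remaining debt of `teravainen2024_prop_2_11_quadratic` is precisely the general-quadratic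
counterpart of Iwaniec's Proposition 1 / Corollary (Lemke Oliver 2012, Lemmas 3, 4, 8: Hooley's
method with classes of binary quadratic forms of discriminant `disc G`, Pell units, Weil's bound
for Kloosterman sums [cite: LemkeOliverActaArith2012, §2]) — the same input the tree's
`Iwaniec1978.theorem_quadratic` is waiting for (`IwaniecAlmostPrimesQuadratic.lean`).  Teräväinen's
printed route (Harman's half-dimensional sieve for `x² − D`, [cite: Harman2008]) needs an input
of the same kind.

## References

* J. Teräväinen, Amer. J. Math. 146 (2024) 1115–1167, Def. 2.9, Prop. 2.11, §7. [Teravainen2024]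
* H. Iwaniec, Invent. Math. 47 (1978) 171–188, Corollary p. 176. [IwaniecInventiones1978]
* R. J. Lemke Oliver, Acta Arith. 151 (2012) 241–261, §2. [LemkeOliverActaArith2012]
* E. Landau, Math. Ann. 56 (1903), §13 (prime ideal theorem; the tree's `DegreeOnePrimesPNT`).
  [LandauMathAnn1903]
-/

open Finset Real Filter Polynomial
open scoped Classical

noncomputable section

namespace Literature.NumberTheory.Sieve

namespace PropertyS

/-! ### A. Generic counting lemmas -/

/-- Summing an indicator-weighted function over a superset. [folklore] -/
theorem sum_filter_indicator_mul_eq {S A : Finset ℕ} (hAS : A ⊆ S) (f : ℕ → ℝ) :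
    ∑ n ∈ S, (if n ∈ A then (1 : ℝ) else 0) * f n = ∑ n ∈ A, f n := by
  rw [← Finset.sum_subset hAS]
  · exact Finset.sum_congr rfl fun n hn => by simp only [if_pos hn, one_mul]
  · intro n _ hn
    simp only [if_neg hn, zero_mul]

/-- **A bilinear level-of-distribution bound applied to prime-indicator coefficients.**  If
`∑_{m ∈ Ico 1 M} |∑_{n ∈ (Ico 1 N) coprime to m} b_n R(mn)| ≤ E` for all coefficient sequences
`|b| ≤ 1` supported on squarefree integers, then for a set `A` of primes `< N` and a set
`B ⊆ [1, M)` of moduli coprime to the members of `A`, `|∑_{m ∈ B} ∑_{n ∈ A} R(mn)| ≤ E`.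
[folklore] -/
theorem abs_sum_sum_le_of_bilinear {R : ℕ → ℝ} {M N : ℕ} {E : ℝ}
    (hlevel : ∀ b : ℕ → ℝ, (∀ n, |b n| ≤ 1) → (∀ n, ¬ Squarefree n → b n = 0) →
      ∑ m ∈ Finset.Ico 1 M, |∑ n ∈ (Finset.Ico 1 N).filter (fun n : ℕ => n.Coprime m),
        b n * R (m * n)| ≤ E)
    {A B : Finset ℕ} (hA : ∀ n ∈ A, n.Prime ∧ n < N) (hB : ∀ m ∈ B, 1 ≤ m ∧ m < M)
    (hAB : ∀ n ∈ A, ∀ m ∈ B, n.Coprime m) :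
    |∑ m ∈ B, ∑ n ∈ A, R (m * n)| ≤ E := by
  set b : ℕ → ℝ := fun n => if n ∈ A then (1 : ℝ) else 0 with hb
  have hb1 : ∀ n, |b n| ≤ 1 := fun n => by
    simp only [hb]; split_ifs <;> simp
  have hb2 : ∀ n, ¬ Squarefree n → b n = 0 := fun n hn => by
    simp only [hb]
    rw [if_neg]
    intro hnA
    exact hn (hA n hnA).1.prime.squarefree
  have hmain := hlevel b hb1 hb2
  have hBsub : B ⊆ Finset.Ico 1 M := fun m hm => Finset.mem_Ico.mpr (hB m hm)
  have heq : ∀ m ∈ B, ∑ n ∈ (Finset.Ico 1 N).filter (fun n : ℕ => n.Coprime m),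
      b n * R (m * n) = ∑ n ∈ A, R (m * n) := by
    intro m hm
    refine sum_filter_indicator_mul_eq (fun n hn => ?_) _
    rw [Finset.mem_filter, Finset.mem_Ico]
    exact ⟨⟨(hA n hn).1.one_lt.le, (hA n hn).2⟩, hAB n hn m hm⟩
  calc |∑ m ∈ B, ∑ n ∈ A, R (m * n)|
      ≤ ∑ m ∈ B, |∑ n ∈ A, R (m * n)| := Finset.abs_sum_le_sum_abs _ _
    _ = ∑ m ∈ B, |∑ n ∈ (Finset.Ico 1 N).filter (fun n : ℕ => n.Coprime m), b n * R (m * n)| :=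
        Finset.sum_congr rfl fun m hm => by rw [heq m hm]
    _ ≤ ∑ m ∈ Finset.Ico 1 M,
          |∑ n ∈ (Finset.Ico 1 N).filter (fun n : ℕ => n.Coprime m), b n * R (m * n)| :=
        Finset.sum_le_sum_of_subset_of_nonneg hBsub fun _ _ _ => abs_nonneg _
    _ ≤ E := hmain

/-- Exchange of summation for pair counts with an arbitrary divisibility-type predicate.
[folklore] -/
theorem sum_sum_card_filter_eq (A B I : Finset ℕ) (Rel : ℕ → ℕ → Prop) [∀ k d, Decidable (Rel k d)] :
    ∑ m ∈ B, ∑ n ∈ A, ((I.filter fun k : ℕ => Rel k (m * n)).card : ℝ) =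
      ∑ k ∈ I, (((B ×ˢ A).filter fun q : ℕ × ℕ => Rel k (q.1 * q.2)).card : ℝ) := by
  simp only [Finset.card_filter, Nat.cast_sum, Nat.cast_ite, Nat.cast_one, Nat.cast_zero]
  calc ∑ m ∈ B, ∑ n ∈ A, ∑ k ∈ I, (if Rel k (m * n) then (1 : ℝ) else 0)
      = ∑ m ∈ B, ∑ k ∈ I, ∑ n ∈ A, (if Rel k (m * n) then (1 : ℝ) else 0) :=
        Finset.sum_congr rfl fun _ _ => Finset.sum_comm
    _ = ∑ k ∈ I, ∑ m ∈ B, ∑ n ∈ A, (if Rel k (m * n) then (1 : ℝ) else 0) := Finset.sum_comm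
    _ = ∑ k ∈ I, ∑ q ∈ B ×ˢ A, (if Rel k (q.1 * q.2) then (1 : ℝ) else 0) :=
        Finset.sum_congr rfl fun k _ => by rw [Finset.sum_product]

/-- **The smoothness mechanism** (integer form): if primes `m, n` with `(mn : ℤ) ∣ g`, `g ≠ 0`,
then every prime `p ∣ g` is `m`, or `n`, or satisfies `p · mn ≤ |g|`. [folklore] -/
theorem prime_dvd_cases {g : ℤ} (hg : g ≠ 0) {m n : ℕ} (hm : m.Prime) (hn : n.Prime)
    (hdvd : ((m * n : ℕ) : ℤ) ∣ g) {p : ℕ} (hp : p.Prime) (hpd : (p : ℤ) ∣ g) :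
    p = m ∨ p = n ∨ p * (m * n) ≤ g.natAbs := by
  have hdvd' : m * n ∣ g.natAbs := Int.natCast_dvd.mp hdvd
  have hpd' : p ∣ g.natAbs := Int.natCast_dvd.mp hpd
  obtain ⟨r, hr⟩ := hdvd'
  have hg' : g.natAbs ≠ 0 := Int.natAbs_ne_zero.mpr hg
  rw [hr] at hpd'
  rcases (Nat.Prime.dvd_mul hp).mp hpd' with h | h
  · rcases (Nat.Prime.dvd_mul hp).mp h with h' | h'
    · exact Or.inl ((Nat.prime_dvd_prime_iff_eq hp hm).mp h')
    · exact Or.inr (Or.inl ((Nat.prime_dvd_prime_iff_eq hp hn).mp h'))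
  · right; right
    have hr0 : 0 < r := by
      rcases Nat.eq_zero_or_pos r with h0 | h0
      · rw [h0, mul_zero] at hr; exact absurd hr hg'
      · exact h0
    rw [hr, mul_comm]
    exact Nat.mul_le_mul_left _ (Nat.le_of_dvd hr0 h)

/-- **Multiplicity**: if all members of `A` and `B` are primes `> z > 1`, the number of pairs
`(m, n) ∈ B × A` with `mn ∣ N` (`N ≥ 1`) is at most `(log N / log z)²`. [folklore] -/
theorem card_pairs_dvd_le' {A B : Finset ℕ} {z : ℝ} (hz : 1 < z) {N : ℕ} (hN : N ≠ 0)
    (hA : ∀ n ∈ A, n.Prime ∧ z < n) (hB : ∀ m ∈ B, m.Prime ∧ z < m) :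
    (((B ×ˢ A).filter fun q : ℕ × ℕ => q.1 * q.2 ∣ N).card : ℝ) ≤
      (Real.log N / Real.log z) ^ 2 := by
  set F : Finset ℕ := N.primeFactors.filter fun p : ℕ => z < p with hF
  have hsub : ((B ×ˢ A).filter fun q : ℕ × ℕ => q.1 * q.2 ∣ N) ⊆ F ×ˢ F := by
    intro q hq
    rw [Finset.mem_filter, Finset.mem_product] at hq
    obtain ⟨⟨hqB, hqA⟩, hq⟩ := hq
    rw [Finset.mem_product, hF, Finset.mem_filter, Finset.mem_filter, Nat.mem_primeFactors,
      Nat.mem_primeFactors]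
    exact ⟨⟨⟨(hB _ hqB).1, (dvd_mul_right q.1 q.2).trans hq, hN⟩, (hB _ hqB).2⟩,
      ⟨⟨(hA _ hqA).1, (dvd_mul_left q.2 q.1).trans hq, hN⟩, (hA _ hqA).2⟩⟩
  have hzF : ∀ p ∈ F, z < (p : ℝ) := fun p hp => by
    rw [hF, Finset.mem_filter] at hp; exact hp.2
  have hprod_dvd : ∏ p ∈ F, p ∣ N :=
    (Finset.prod_dvd_prod_of_subset _ _ _ (Finset.filter_subset _ _)).trans
      (Nat.prod_primeFactors_dvd _)
  have hprod_le : ((∏ p ∈ F, p : ℕ) : ℝ) ≤ N := by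
    exact_mod_cast Nat.le_of_dvd (Nat.pos_of_ne_zero hN) hprod_dvd
  have hpow_le : z ^ F.card ≤ ((∏ p ∈ F, p : ℕ) : ℝ) := by
    push_cast
    rw [← Finset.prod_const]
    exact Finset.prod_le_prod (fun _ _ => by linarith) fun p hp => (hzF p hp).le
  have hlogz : 0 < Real.log z := Real.log_pos hz
  have hcardF : (F.card : ℝ) ≤ Real.log N / Real.log z := by
    rw [le_div_iff₀ hlogz]
    have h1 : Real.log (z ^ F.card) ≤ Real.log N :=
      Real.log_le_log (by positivity) (hpow_le.trans hprod_le)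
    rwa [Real.log_pow] at h1
  calc (((B ×ˢ A).filter fun q : ℕ × ℕ => q.1 * q.2 ∣ N).card : ℝ)
      ≤ ((F ×ˢ F).card : ℝ) := by exact_mod_cast Finset.card_le_card hsub
    _ = (F.card : ℝ) * F.card := by rw [Finset.card_product]; push_cast; ring
    _ ≤ (Real.log N / Real.log z) * (Real.log N / Real.log z) :=
        mul_le_mul hcardF hcardF (Nat.cast_nonneg _) (le_trans (Nat.cast_nonneg _) hcardF)
    _ = (Real.log N / Real.log z) ^ 2 := by ring

/-! ### B. The monic model and Mertens' theorem for the root count of a quadratic -/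

/-- Evaluation of a quadratic over `ZMod p` (or any ring) through its three coefficients.
[folklore] -/
theorem eval_map_eq_of_natDegree_eq_two {S : Type*} [CommRing S] (φ : ℤ →+* S) {G : ℤ[X]}
    (hdeg : G.natDegree = 2) (x : S) :
    (G.map φ).eval x = φ (G.coeff 2) * x ^ 2 + φ (G.coeff 1) * x + φ (G.coeff 0) := by
  rw [Polynomial.eval_map, Polynomial.eval₂_eq_sum_range, hdeg]
  simp [Finset.sum_range_succ]
  ring

/-- The monic model `g = Y² + bY + ac` of `G = aY² + bY + c` evaluates as printed. [folklore] -/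
theorem eval_map_monicModel {S : Type*} [CommRing S] (φ : ℤ →+* S) (a b c : ℤ) (x : S) :
    ((X ^ 2 + (C b * X + C (a * c)) : ℤ[X]).map φ |>.eval x) = x ^ 2 + φ b * x + φ a * φ c := by
  simp
  ring

/-- The monic model is monic. [folklore] -/
theorem monic_monicModel (b e : ℤ) : ((X ^ 2 + (C b * X + C e)) : ℤ[X]).Monic := by
  apply Polynomial.monic_X_pow_add
  refine (Polynomial.degree_add_le _ _).trans_lt ?_
  rw [max_lt_iff]
  constructor
  · calc (C b * X).degree ≤ (C b).degree + X.degree := Polynomial.degree_mul_le _ _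
      _ ≤ 0 + 1 := add_le_add Polynomial.degree_C_le Polynomial.degree_X_le
      _ < 2 := by norm_num
  · exact Polynomial.degree_C_le.trans_lt (by norm_num)

/-- **Root counts of a quadratic and of its monic model agree at primes not dividing the leading
coefficient**: `ν_G(p) = ν_g(p)` for `p ∤ a`, via `x ↦ ax` on `ℤ/p` (`a G(x) = g(ax)`).
[folklore] -/
theorem polyRootCountMod_eq_monicModel {G : ℤ[X]} (hdeg : G.natDegree = 2) {p : ℕ} (hp : p.Prime)
    (hpa : ¬ (p : ℤ) ∣ G.coeff 2) :
    polyRootCountMod ![G] p =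
      polyRootCountMod ![(X ^ 2 + (C (G.coeff 1) * X + C (G.coeff 2 * G.coeff 0)) : ℤ[X])] p := by
  haveI := Fact.mk hp
  set a : ZMod p := (G.coeff 2 : ZMod p) with ha
  have ha0 : a ≠ 0 := by
    rw [ha, Ne, ZMod.intCast_zmod_eq_zero_iff_dvd]; exact hpa
  rw [← card_polyRootsMod, ← card_polyRootsMod]
  refine Finset.card_bij (fun x _ => a * x) ?_ ?_ ?_
  · intro x hx
    rw [mem_polyRootsMod] at hx ⊢
    rw [eval_map_eq_of_natDegree_eq_two _ hdeg] at hx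
    rw [eval_map_monicModel]
    simp only [eq_intCast] at hx ⊢
    rw [← ha] at hx ⊢
    have : (a * x) ^ 2 + (G.coeff 1 : ZMod p) * (a * x) + a * (G.coeff 0 : ZMod p) =
        a * (a * x ^ 2 + (G.coeff 1 : ZMod p) * x + (G.coeff 0 : ZMod p)) := by ring
    rw [this, hx, mul_zero]
  · intro x _ y _ h
    exact mul_left_cancel₀ ha0 h
  · intro y hy
    refine ⟨a⁻¹ * y, ?_, by rw [← mul_assoc, mul_inv_cancel₀ ha0, one_mul]⟩
    rw [mem_polyRootsMod] at hy ⊢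
    rw [eval_map_monicModel] at hy
    rw [eval_map_eq_of_natDegree_eq_two _ hdeg]
    simp only [eq_intCast] at hy ⊢
    rw [← ha] at hy ⊢
    have : a * (a⁻¹ * y) ^ 2 + (G.coeff 1 : ZMod p) * (a⁻¹ * y) + (G.coeff 0 : ZMod p) =
        a⁻¹ * (y ^ 2 + (G.coeff 1 : ZMod p) * y + a * (G.coeff 0 : ZMod p)) := by
      field_simp
    rw [this, hy, mul_zero]

/-- **The monic model of a quadratic irreducible over `ℚ` is irreducible in `ℤ[X]`**: a rational
root `r` of `g = Y² + bY + ac` would give the rational root `r/a` of `G` (`a G(Y/a) = g(Y)`).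
[folklore] -/
theorem irreducible_monicModel {G : ℤ[X]} (hdeg : G.natDegree = 2)
    (hirr : Irreducible (G.map (Int.castRingHom ℚ))) :
    Irreducible ((X ^ 2 + (C (G.coeff 1) * X + C (G.coeff 2 * G.coeff 0)) : ℤ[X])) := by
  set g : ℤ[X] := X ^ 2 + (C (G.coeff 1) * X + C (G.coeff 2 * G.coeff 0)) with hg
  have hmonic : g.Monic := monic_monicModel _ _
  refine hmonic.irreducible_of_irreducible_map (Int.castRingHom ℚ) _ ?_
  have ha0 : (G.coeff 2 : ℚ) ≠ 0 := by
    have : G.leadingCoeff ≠ 0 := by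
      rw [Ne, Polynomial.leadingCoeff_eq_zero]; rintro rfl; simp at hdeg
    rw [Polynomial.leadingCoeff, hdeg] at this
    exact_mod_cast this
  have hgnat : g.natDegree = 2 := by
    rw [hg, Polynomial.natDegree_add_eq_left_of_degree_lt]
    · simp
    · refine (Polynomial.degree_add_le _ _).trans_lt ?_
      rw [Polynomial.degree_X_pow, max_lt_iff]
      constructor
      · calc (C (G.coeff 1) * X).degree ≤ (C (G.coeff 1)).degree + X.degree :=
            Polynomial.degree_mul_le _ _
          _ ≤ 0 + 1 := add_le_add Polynomial.degree_C_le Polynomial.degree_X_le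
          _ < (2 : ℕ) := by norm_num
      · exact Polynomial.degree_C_le.trans_lt (by norm_num)
  have hgdeg : (g.map (Int.castRingHom ℚ)).natDegree = 2 := by
    rw [hmonic.natDegree_map, hgnat]
  have hGdeg : (G.map (Int.castRingHom ℚ)).natDegree = 2 := by
    rw [Polynomial.natDegree_map_eq_of_injective Int.cast_injective, hdeg]
  rw [Polynomial.irreducible_iff_roots_eq_zero_of_degree_le_three (by omega) (by omega),
    Multiset.eq_zero_iff_forall_notMem]
  intro r hr
  have hg0 : g.map (Int.castRingHom ℚ) ≠ 0 := by
    intro h0; rw [h0, Polynomial.natDegree_zero] at hgdeg; omega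
  have hroot : (g.map (Int.castRingHom ℚ)).IsRoot r := (Polynomial.mem_roots hg0).mp hr
  -- `r / a` is a root of `G`
  have hGroot : (G.map (Int.castRingHom ℚ)).IsRoot (r / (G.coeff 2 : ℚ)) := by
    rw [Polynomial.IsRoot, eval_map_eq_of_natDegree_eq_two _ hdeg]
    rw [Polynomial.IsRoot, hg, eval_map_monicModel] at hroot
    simp only [eq_intCast] at hroot ⊢
    have : (G.coeff 2 : ℚ) * (r / (G.coeff 2 : ℚ)) ^ 2 + (G.coeff 1 : ℚ) * (r / (G.coeff 2 : ℚ)) +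
        (G.coeff 0 : ℚ) =
        (r ^ 2 + (G.coeff 1 : ℚ) * r + (G.coeff 2 : ℚ) * (G.coeff 0 : ℚ)) / (G.coeff 2 : ℚ) := by
      field_simp
    rw [this, hroot, zero_div]
  have h1 := Polynomial.degree_eq_one_of_irreducible_of_root hirr hGroot
  have h2 : (G.map (Int.castRingHom ℚ)).degree = 2 := by
    rw [Polynomial.degree_eq_natDegree, hGdeg]
    · rfl
    · intro h0; rw [h0, Polynomial.natDegree_zero] at hGdeg; omega
  rw [h2] at h1
  exact absurd h1 (by decide)

/-- **Mertens' theorem for the root count of a quadratic irreducible over `ℚ`, on ranges of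
primes**: there is `C` (depending on `G`) such that for `max(2, |a|) ≤ u ≤ v` (`a` the leading
coefficient), `∑_{u < p ≤ v} ν_G(p)/p ≥ log log v − log log u − 2C/log u`.  From the tree's
Mertens theorem with rate for the roots of a monic irreducible polynomial (prime ideal theorem,
`DegreeOnePrimes.sum_primesLE_rootCount_div_eq`) applied to the monic model.
[cite: LandauMathAnn1903, §13 (prime ideal theorem; via the tree's DegreeOnePrimesPNT)] -/
theorem exists_sum_range_polyRootCountMod_div_ge {G : ℤ[X]} (hdeg : G.natDegree = 2)
    (hirr : Irreducible (G.map (Int.castRingHom ℚ))) :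
    ∃ C : ℝ, ∀ u v : ℝ, 2 ≤ u → (|G.coeff 2| : ℝ) < u → u ≤ v →
      Real.log (Real.log v) - Real.log (Real.log u) - 2 * C / Real.log u ≤
        ∑ p ∈ (Nat.primesLE ⌊v⌋₊).filter (fun p : ℕ => u < (p : ℝ)),
          (polyRootCountMod ![G] p : ℝ) / p := by
  set g : ℤ[X] := X ^ 2 + (C (G.coeff 1) * X + C (G.coeff 2 * G.coeff 0)) with hg
  obtain ⟨c, C, hC⟩ := Literature.NumberTheory.LFunctions.DegreeOnePrimes.sum_primesLE_rootCount_div_eq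
    (monic_monicModel (G.coeff 1) (G.coeff 2 * G.coeff 0)) (irreducible_monicModel hdeg hirr) 0
  have hC0 : 0 ≤ C := by
    have := hC 2 le_rfl
    have hlog : 0 < Real.log 2 := Real.log_pos one_lt_two
    exact le_of_mul_le_mul_right (by
      calc 0 * (Real.log 2 ^ (0 + 1))⁻¹ = 0 := by ring
        _ ≤ |∑ p ∈ Nat.primesLE ⌊(2 : ℝ)⌋₊,
            ((#((range p).filter fun n : ℕ => (p : ℤ) ∣ g.eval (n : ℤ)) : ℝ)) / p -
              (Real.log (Real.log 2) + c)| := abs_nonneg _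
        _ ≤ C / Real.log 2 ^ (0 + 1) := this
        _ = C * (Real.log 2 ^ (0 + 1))⁻¹ := div_eq_mul_inv _ _) (by positivity)
  refine ⟨C, fun u v hu hau huv => ?_⟩
  -- the range sum for `G` equals the range sum for `g`
  set S : ℝ → ℝ := fun x => ∑ p ∈ Nat.primesLE ⌊x⌋₊,
    ((#((range p).filter fun n : ℕ => (p : ℤ) ∣ g.eval (n : ℤ)) : ℝ)) / p with hS
  have hrange : ∑ p ∈ (Nat.primesLE ⌊v⌋₊).filter (fun p : ℕ => u < (p : ℝ)),
      (polyRootCountMod ![G] p : ℝ) / p = S v - S u := by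
    have hsplit := Finset.sum_filter_add_sum_filter_not (Nat.primesLE ⌊v⌋₊)
      (fun p : ℕ => u < (p : ℝ))
      (fun p : ℕ => ((#((range p).filter fun n : ℕ => (p : ℤ) ∣ g.eval (n : ℤ)) : ℝ)) / p)
    rw [primesLE_filter_not_lt (by linarith) huv] at hsplit
    have heq : ∑ p ∈ (Nat.primesLE ⌊v⌋₊).filter (fun p : ℕ => u < (p : ℝ)),
        (polyRootCountMod ![G] p : ℝ) / p =
        ∑ p ∈ (Nat.primesLE ⌊v⌋₊).filter (fun p : ℕ => u < (p : ℝ)),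
          ((#((range p).filter fun n : ℕ => (p : ℤ) ∣ g.eval (n : ℤ)) : ℝ)) / p := by
      refine Finset.sum_congr rfl fun p hp => ?_
      rw [Finset.mem_filter, Nat.mem_primesLE] at hp
      have hpa : ¬ (p : ℤ) ∣ G.coeff 2 := by
        intro h
        have h1 : (p : ℤ) ≤ |G.coeff 2| := Int.le_of_dvd (abs_pos.mpr (by
          intro h0
          have : G.leadingCoeff = 0 := by rw [Polynomial.leadingCoeff, hdeg, h0]
          rw [Polynomial.leadingCoeff_eq_zero] at this
          rw [this] at hdeg; simp at hdeg)) ((dvd_abs _ _).mpr h)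
        have h2 : ((p : ℤ) : ℝ) ≤ ((|G.coeff 2| : ℤ) : ℝ) := by exact_mod_cast h1
        push_cast at h2
        linarith [hp.2]
      rw [polyRootCountMod_eq_monicModel hdeg hp.1.2 hpa, ← card_filter_dvd_eval_eq_polyRootCountMod]
    rw [heq, hS]
    linarith
  rw [hrange]
  have hv : 2 ≤ v := hu.trans huv
  have h1 := hC v hv
  have h2 := hC u hu
  simp only [zero_add, pow_one] at h1 h2
  rw [abs_le] at h1 h2
  have hlogu : 0 < Real.log u := Real.log_pos (by linarith)
  have hlogv : Real.log u ≤ Real.log v := Real.log_le_log (by linarith) huv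
  have hCu : C / Real.log v ≤ C / Real.log u :=
    div_le_div_of_nonneg_left hC0 hlogu hlogv
  have : 2 * C / Real.log u = C / Real.log u + C / Real.log u := by ring
  rw [this]
  simp only [hS] at h1 h2 ⊢
  linarith [h1.1, h2.2]

/-! ### C. Window counts for a general polynomial and the level-of-distribution lower bound -/

/-- `#{y < t ≤ 2y : d ∣ G(t)} = N_G(2y; d) − N_G(y; d)`. [folklore] -/
theorem card_window_dvd_eval_eq (G : ℤ[X]) {y : ℝ} (hy : 0 ≤ y) (d : ℕ) :
    ((((Finset.Ioc ⌊y⌋₊ ⌊2 * y⌋₊).filter fun t : ℕ => (d : ℤ) ∣ G.eval (t : ℤ)).card : ℕ) : ℝ) =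
      ((((Finset.Icc 1 ⌊2 * y⌋₊).filter fun t : ℕ => (d : ℤ) ∣ G.eval (t : ℤ)).card : ℕ) : ℝ) -
        ((((Finset.Icc 1 ⌊y⌋₊).filter fun t : ℕ => (d : ℤ) ∣ G.eval (t : ℤ)).card : ℕ) : ℝ) := by
  have hle : ⌊y⌋₊ ≤ ⌊2 * y⌋₊ := Nat.floor_mono (by linarith)
  have hIcc : ∀ n : ℕ, Finset.Icc 1 n = Finset.Ioc 0 n := fun n => by
    ext k; simp only [Finset.mem_Icc, Finset.mem_Ioc]; omega
  rw [hIcc, hIcc, ← Finset.Ioc_union_Ioc_eq_Ioc (Nat.zero_le _) hle, Finset.filter_union,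
    Finset.card_union_of_disjoint
      (Finset.disjoint_filter_filter (Finset.Ioc_disjoint_Ioc_of_le le_rfl))]
  push_cast
  ring

/-- **Lower bound for the pair count in the window from a bilinear level of distribution.**
With `N_G(x; d) = #{1 ≤ t ≤ x : d ∣ G(t)}`, `ρ_G = polyRootCountMod ![G]` and
`r_G(x; d) = N_G(x; d) − ρ_G(d) x/d`: if at `x = y` and `x = 2y` the bilinear bound
`∑_{m < M_x} |∑_{n < N_x, (n,m)=1} b_n r_G(x; mn)| ≤ E_x` holds for all admissible `b`, then for
primes `A` below both `N_x` and moduli `B` below both `M_x`, pairwise coprime,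
`∑_{m ∈ B} ∑_{n ∈ A} #{y < t ≤ 2y : mn ∣ G(t)} ≥ y (∑_B ρ_G(m)/m)(∑_A ρ_G(n)/n) − E_{2y} − E_y`.
[folklore] -/
theorem sum_sum_card_window_ge_of_level (G : ℤ[X]) {y : ℝ} (hy : 0 ≤ y)
    {M₁ N₁ M₂ N₂ : ℕ} {E₁ E₂ : ℝ}
    (hlevel₁ : ∀ b : ℕ → ℝ, (∀ n, |b n| ≤ 1) → (∀ n, ¬ Squarefree n → b n = 0) →
      ∑ m ∈ Finset.Ico 1 M₁, |∑ n ∈ (Finset.Ico 1 N₁).filter (fun n : ℕ => n.Coprime m),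
        b n * (((((Finset.Icc 1 ⌊y⌋₊).filter fun t : ℕ =>
            ((m * n : ℕ) : ℤ) ∣ G.eval (t : ℤ)).card : ℕ) : ℝ) -
          (polyRootCountMod ![G] (m * n) : ℝ) * y / ((m * n : ℕ) : ℝ))| ≤ E₁)
    (hlevel₂ : ∀ b : ℕ → ℝ, (∀ n, |b n| ≤ 1) → (∀ n, ¬ Squarefree n → b n = 0) →
      ∑ m ∈ Finset.Ico 1 M₂, |∑ n ∈ (Finset.Ico 1 N₂).filter (fun n : ℕ => n.Coprime m),
        b n * (((((Finset.Icc 1 ⌊2 * y⌋₊).filter fun t : ℕ =>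
            ((m * n : ℕ) : ℤ) ∣ G.eval (t : ℤ)).card : ℕ) : ℝ) -
          (polyRootCountMod ![G] (m * n) : ℝ) * (2 * y) / ((m * n : ℕ) : ℝ))| ≤ E₂)
    {A B : Finset ℕ} (hA : ∀ n ∈ A, n.Prime ∧ n < N₁ ∧ n < N₂)
    (hB : ∀ m ∈ B, 1 ≤ m ∧ m < M₁ ∧ m < M₂) (hAB : ∀ n ∈ A, ∀ m ∈ B, n.Coprime m) :
    y * (∑ m ∈ B, (polyRootCountMod ![G] m : ℝ) / m) *
        (∑ n ∈ A, (polyRootCountMod ![G] n : ℝ) / n) - E₂ - E₁ ≤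
      ∑ m ∈ B, ∑ n ∈ A, ((((Finset.Ioc ⌊y⌋₊ ⌊2 * y⌋₊).filter fun t : ℕ =>
        ((m * n : ℕ) : ℤ) ∣ G.eval (t : ℤ)).card : ℕ) : ℝ) := by
  -- remainders at `y` and `2y`
  set R₁ : ℕ → ℝ := fun d => ((((Finset.Icc 1 ⌊y⌋₊).filter fun t : ℕ =>
      (d : ℤ) ∣ G.eval (t : ℤ)).card : ℕ) : ℝ) - (polyRootCountMod ![G] d : ℝ) * y / d with hR₁
  set R₂ : ℕ → ℝ := fun d => ((((Finset.Icc 1 ⌊2 * y⌋₊).filter fun t : ℕ =>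
      (d : ℤ) ∣ G.eval (t : ℤ)).card : ℕ) : ℝ) - (polyRootCountMod ![G] d : ℝ) * (2 * y) / d
    with hR₂
  have h₁ : |∑ m ∈ B, ∑ n ∈ A, R₁ (m * n)| ≤ E₁ :=
    abs_sum_sum_le_of_bilinear (R := R₁) hlevel₁ (fun n hn => ⟨(hA n hn).1, (hA n hn).2.1⟩)
      (fun m hm => ⟨(hB m hm).1, (hB m hm).2.1⟩) hAB
  have h₂ : |∑ m ∈ B, ∑ n ∈ A, R₂ (m * n)| ≤ E₂ :=
    abs_sum_sum_le_of_bilinear (R := R₂) hlevel₂ (fun n hn => ⟨(hA n hn).1, (hA n hn).2.2⟩)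
      (fun m hm => ⟨(hB m hm).1, (hB m hm).2.2⟩) hAB
  -- decomposition of the window count
  have hdec : ∑ m ∈ B, ∑ n ∈ A, ((((Finset.Ioc ⌊y⌋₊ ⌊2 * y⌋₊).filter fun t : ℕ =>
      ((m * n : ℕ) : ℤ) ∣ G.eval (t : ℤ)).card : ℕ) : ℝ) =
      y * (∑ m ∈ B, (polyRootCountMod ![G] m : ℝ) / m) *
        (∑ n ∈ A, (polyRootCountMod ![G] n : ℝ) / n) +
      ∑ m ∈ B, ∑ n ∈ A, R₂ (m * n) - ∑ m ∈ B, ∑ n ∈ A, R₁ (m * n) := by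
    rw [mul_assoc, Finset.sum_mul_sum, Finset.mul_sum, ← Finset.sum_add_distrib,
      ← Finset.sum_sub_distrib]
    refine Finset.sum_congr rfl fun m hm => ?_
    rw [Finset.mul_sum, ← Finset.sum_add_distrib, ← Finset.sum_sub_distrib]
    refine Finset.sum_congr rfl fun n hn => ?_
    simp only [hR₁, hR₂]
    rw [card_window_dvd_eval_eq G hy, polyRootCountMod_mul_of_coprime _ (hAB n hn m hm).symm]
    have hm0 : (m : ℝ) ≠ 0 := by have := (hB m hm).1; positivity
    have hn0 : (n : ℝ) ≠ 0 := by have := (hA n hn).1.pos; positivity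
    push_cast
    field_simp
    ring
  rw [hdec]
  rw [abs_le] at h₁ h₂
  linarith [h₁.2, h₂.1]

/-- **Upper bound for the pair count by the smooth count** for a general polynomial `G` without
integer roots, `|G(t)| ≤ K t²` on `t ≥ 1`: if `A, B` consist of primes `> z > 1`, the members of
`A` are `≤ y`, those of `B` are `≤ y`, and `mn > 2Ky` on `B × A`, then
`∑_{m ∈ B} ∑_{n ∈ A} #{y < t ≤ 2y : mn ∣ G(t)} ≤ (log M/log z)² · #{y < t ≤ 2y : G(t) is t-smooth}`
for any `M` with `|G(t)| ≤ M` on the window. [folklore] -/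
theorem sum_sum_card_window_le_smooth (G : ℤ[X]) {K : ℝ} (hK : 0 ≤ K)
    (hGK : ∀ t : ℕ, 1 ≤ t → (((G.eval (t : ℤ)).natAbs : ℕ) : ℝ) ≤ K * (t : ℝ) ^ 2)
    (hG0 : ∀ t : ℤ, G.eval t ≠ 0) {y z M : ℝ} (hy : 1 ≤ y) (hz : 1 < z)
    (hM : ∀ t : ℕ, ⌊y⌋₊ < t → t ≤ ⌊2 * y⌋₊ → (((G.eval (t : ℤ)).natAbs : ℕ) : ℝ) ≤ M)
    {A B : Finset ℕ} (hA : ∀ n ∈ A, n.Prime ∧ z < n ∧ (n : ℝ) ≤ y)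
    (hB : ∀ m ∈ B, m.Prime ∧ z < m ∧ (m : ℝ) ≤ y)
    (hbig : ∀ m ∈ B, ∀ n ∈ A, 2 * K * y < (m : ℝ) * n) :
    ∑ m ∈ B, ∑ n ∈ A, ((((Finset.Ioc ⌊y⌋₊ ⌊2 * y⌋₊).filter fun t : ℕ =>
        ((m * n : ℕ) : ℤ) ∣ G.eval (t : ℤ)).card : ℕ) : ℝ) ≤
      (Real.log M / Real.log z) ^ 2 *
        (((Finset.Ioc ⌊y⌋₊ ⌊2 * y⌋₊).filter fun t : ℕ =>
          ∀ p : ℕ, p.Prime → (p : ℤ) ∣ G.eval (t : ℤ) → p ≤ t).card : ℝ) := by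
  rw [sum_sum_card_filter_eq A B (Finset.Ioc ⌊y⌋₊ ⌊2 * y⌋₊)
    (fun t d => ((d : ℕ) : ℤ) ∣ G.eval (t : ℤ))]
  set I := Finset.Ioc ⌊y⌋₊ ⌊2 * y⌋₊ with hI
  set L := (Real.log M / Real.log z) ^ 2 with hL
  have hL0 : 0 ≤ L := sq_nonneg _
  have hy0 : 0 ≤ y := by linarith
  have hpt : ∀ t ∈ I,
      (((B ×ˢ A).filter fun q : ℕ × ℕ => ((q.1 * q.2 : ℕ) : ℤ) ∣ G.eval (t : ℤ)).card : ℝ) ≤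
        if (∀ p : ℕ, p.Prime → (p : ℤ) ∣ G.eval (t : ℤ) → p ≤ t) then L else 0 := by
    intro t ht
    rw [hI, Finset.mem_Ioc] at ht
    have ht2y : (t : ℝ) ≤ 2 * y := by
      have : (t : ℝ) ≤ ⌊2 * y⌋₊ := by exact_mod_cast ht.2
      exact this.trans (Nat.floor_le (by linarith))
    have ht1 : 1 ≤ t := by omega
    rcases Finset.eq_empty_or_nonempty
        ((B ×ˢ A).filter fun q : ℕ × ℕ => ((q.1 * q.2 : ℕ) : ℤ) ∣ G.eval (t : ℤ)) with h0 | hne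
    · rw [h0, Finset.card_empty, Nat.cast_zero]
      split_ifs <;> linarith
    · obtain ⟨q, hq⟩ := hne
      rw [Finset.mem_filter, Finset.mem_product] at hq
      obtain ⟨⟨hqB, hqA⟩, hqdvd⟩ := hq
      obtain ⟨hmP, hzm, hmy⟩ := hB _ hqB
      obtain ⟨hnP, hzn, hny⟩ := hA _ hqA
      have hmt : q.1 ≤ t := (Nat.le_floor hmy).trans ht.1.le
      have hnt : q.2 ≤ t := (Nat.le_floor hny).trans ht.1.le
      have hsmooth : ∀ p : ℕ, p.Prime → (p : ℤ) ∣ G.eval (t : ℤ) → p ≤ t := by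
        intro p hp hpd
        rcases prime_dvd_cases (hG0 t) hmP hnP hqdvd hp hpd with h | h | h
        · rw [h]; exact hmt
        · rw [h]; exact hnt
        · -- `p · mn ≤ |G(t)| ≤ K t²` and `mn > 2Ky ≥ K t`
          have h1 : (p : ℝ) * ((q.1 : ℝ) * q.2) ≤ K * (t : ℝ) ^ 2 := by
            have : ((p * (q.1 * q.2) : ℕ) : ℝ) ≤ ((G.eval (t : ℤ)).natAbs : ℝ) := by
              exact_mod_cast h
            push_cast at this
            exact this.trans (hGK t ht1)
          have h2 : K * (t : ℝ) ≤ (q.1 : ℝ) * q.2 := by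
            have := hbig _ hqB _ hqA
            nlinarith
          by_contra hlt
          push Not at hlt
          have hlt' : (t : ℝ) + 1 ≤ p := by exact_mod_cast hlt
          have ht0 : (0 : ℝ) < t := by exact_mod_cast (by omega : 0 < t)
          have hmn0 : (0 : ℝ) < (q.1 : ℝ) * q.2 := by
            have := hmP.pos; have := hnP.pos; positivity
          nlinarith
      rw [if_pos hsmooth]
      have hGt0 : (G.eval (t : ℤ)).natAbs ≠ 0 := Int.natAbs_ne_zero.mpr (hG0 t)
      have hconv : ((B ×ˢ A).filter fun q : ℕ × ℕ => ((q.1 * q.2 : ℕ) : ℤ) ∣ G.eval (t : ℤ)) =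
          ((B ×ˢ A).filter fun q : ℕ × ℕ => q.1 * q.2 ∣ (G.eval (t : ℤ)).natAbs) := by
        refine Finset.filter_congr fun q _ => ?_
        exact Int.natCast_dvd
      rw [hconv]
      refine (card_pairs_dvd_le' hz hGt0 (fun n hn => ⟨(hA n hn).1, (hA n hn).2.1⟩)
        (fun m hm => ⟨(hB m hm).1, (hB m hm).2.1⟩)).trans ?_
      rw [hL]
      have hlogz : 0 < Real.log z := Real.log_pos hz
      have hGt1 : (1 : ℝ) ≤ ((G.eval (t : ℤ)).natAbs : ℝ) := by
        exact_mod_cast Nat.one_le_iff_ne_zero.mpr hGt0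
      have hlogle : Real.log ((G.eval (t : ℤ)).natAbs : ℝ) ≤ Real.log M :=
        Real.log_le_log (by linarith) (hM t ht.1 ht.2)
      have h0 : 0 ≤ Real.log ((G.eval (t : ℤ)).natAbs : ℝ) / Real.log z :=
        div_nonneg (Real.log_nonneg hGt1) hlogz.le
      have h1 : Real.log ((G.eval (t : ℤ)).natAbs : ℝ) / Real.log z ≤ Real.log M / Real.log z :=
        div_le_div_of_nonneg_right hlogle hlogz.le
      exact pow_le_pow_left₀ h0 h1 2
  calc ∑ t ∈ I, (((B ×ˢ A).filter fun q : ℕ × ℕ =>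
          ((q.1 * q.2 : ℕ) : ℤ) ∣ G.eval (t : ℤ)).card : ℝ)
      ≤ ∑ t ∈ I, (if (∀ p : ℕ, p.Prime → (p : ℤ) ∣ G.eval (t : ℤ) → p ≤ t) then L else 0) :=
        Finset.sum_le_sum hpt
    _ = L * ((I.filter fun t : ℕ =>
          ∀ p : ℕ, p.Prime → (p : ℤ) ∣ G.eval (t : ℤ) → p ≤ t).card : ℝ) := by
        rw [Finset.sum_ite, Finset.sum_const_zero, add_zero, Finset.sum_const, nsmul_eq_mul,
          mul_comm]

/-! ### D. Assembly: smooth values in windows from a level of distribution -/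

/-- A quadratic irreducible over `ℚ` has no integer roots. [folklore] -/
theorem eval_ne_zero_of_irreducible {G : ℤ[X]} (hdeg : G.natDegree = 2)
    (hirr : Irreducible (G.map (Int.castRingHom ℚ))) (t : ℤ) : G.eval t ≠ 0 := by
  intro h0
  have hroot : (G.map (Int.castRingHom ℚ)).IsRoot (t : ℚ) := by
    rw [Polynomial.IsRoot, Polynomial.eval_map, show ((t : ℤ) : ℚ) = Int.castRingHom ℚ t from rfl,
      Polynomial.eval₂_hom, h0, map_zero]
  have h1 := Polynomial.degree_eq_one_of_irreducible_of_root hirr hroot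
  have hGdeg : (G.map (Int.castRingHom ℚ)).natDegree = 2 := by
    rw [Polynomial.natDegree_map_eq_of_injective Int.cast_injective, hdeg]
  have h2 : (G.map (Int.castRingHom ℚ)).degree = 2 := by
    rw [Polynomial.degree_eq_natDegree, hGdeg]
    · rfl
    · intro h; rw [h, Polynomial.natDegree_zero] at hGdeg; omega
  rw [h2] at h1
  exact absurd h1 (by decide)

/-- The size bound `|G(t)| ≤ (|a| + |b| + |c|) t²` for `t ≥ 1`. [folklore] -/
theorem natAbs_eval_le_of_natDegree_eq_two {G : ℤ[X]} (hdeg : G.natDegree = 2) {t : ℕ}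
    (ht : 1 ≤ t) :
    (((G.eval (t : ℤ)).natAbs : ℕ) : ℝ) ≤
      ((|G.coeff 2| + |G.coeff 1| + |G.coeff 0| : ℤ) : ℝ) * (t : ℝ) ^ 2 := by
  rw [eval_eq_of_natDegree_eq_two hdeg, Nat.cast_natAbs]
  push_cast
  have ht' : (1 : ℝ) ≤ t := by exact_mod_cast ht
  have ht0 : (0 : ℝ) ≤ t := by linarith
  calc |((G.coeff 2 : ℤ) : ℝ) * (t : ℝ) ^ 2 + (G.coeff 1 : ℝ) * t + (G.coeff 0 : ℝ)|
      ≤ |((G.coeff 2 : ℤ) : ℝ) * (t : ℝ) ^ 2| + |(G.coeff 1 : ℝ) * t| + |(G.coeff 0 : ℝ)| :=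
        (abs_add_le _ _).trans (add_le_add (abs_add_le _ _) le_rfl)
    _ = |(G.coeff 2 : ℝ)| * (t : ℝ) ^ 2 + |(G.coeff 1 : ℝ)| * t + |(G.coeff 0 : ℝ)| := by
        rw [abs_mul, abs_mul, abs_of_nonneg (by positivity : (0 : ℝ) ≤ (t : ℝ) ^ 2),
          abs_of_nonneg ht0]
    _ ≤ |(G.coeff 2 : ℝ)| * (t : ℝ) ^ 2 + |(G.coeff 1 : ℝ)| * (t : ℝ) ^ 2 +
          |(G.coeff 0 : ℝ)| * (t : ℝ) ^ 2 := by
        have h1 : (t : ℝ) ≤ (t : ℝ) ^ 2 := by nlinarith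
        have h2 : (1 : ℝ) ≤ (t : ℝ) ^ 2 := by nlinarith
        nlinarith [abs_nonneg (G.coeff 1 : ℝ), abs_nonneg (G.coeff 0 : ℝ)]
    _ = (|(G.coeff 2 : ℝ)| + |(G.coeff 1 : ℝ)| + |(G.coeff 0 : ℝ)|) * (t : ℝ) ^ 2 := by ring

/-- **Smooth values in windows from a bilinear level of distribution (the assembly).**  For
every `θ > 0` there is `c > 0` such that for every quadratic `G ∈ ℤ[X]` irreducible over `ℚ`
satisfying the Iwaniec-type level of distribution with inner exponent `θ` — for every `ε > 0`,
`∑_{m < x^{1−4ε}} |∑_{n < x^{θ−ε}, (n,m)=1} b_n (N_G(x; mn) − ρ_G(mn) x/(mn))| ≤ C x^{1−ε}`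
uniformly in `|b| ≤ 1` supported on squarefrees (`N_G(x; d) = #{1 ≤ t ≤ x : d ∣ G(t)}`,
`ρ_G = polyRootCountMod ![G]`) — the value `G(t)` is `t`-smooth for at least `c y` integers
`y < t ≤ 2y`, for all large `y`.  The constant `c` depends on `θ` only (through
`θ₀ = min(θ, 1/16)`: `c = ¼ log(8/5) · ½ log((1 − 0.42θ₀)/(1 − 0.48θ₀)) / (2 (6/θ₀)²)`), which is
what makes property S uniform over progressions.  For `G = X² + 1`, `θ = 1/15` the hypothesis is
Iwaniec's Corollary (`Iwaniec1978.proposition1_corollary_holds`).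
[cite: IwaniecInventiones1978, Corollary p. 176 (shape of the hypothesis)] -/
theorem exists_const_of_level (θ : ℝ) (hθ : 0 < θ) :
    ∃ c : ℝ, 0 < c ∧ ∀ G : ℤ[X], G.natDegree = 2 → Irreducible (G.map (Int.castRingHom ℚ)) →
      (∀ ε : ℝ, 0 < ε → ∃ C : ℝ, ∀ (x : ℝ) (b : ℕ → ℝ), 2 ≤ x → (∀ n, |b n| ≤ 1) →
        (∀ n, ¬ Squarefree n → b n = 0) →
        ∑ m ∈ Finset.Ico 1 ⌈x ^ (1 - 4 * ε)⌉₊,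
          |∑ n ∈ (Finset.Ico 1 ⌈x ^ (θ - ε)⌉₊).filter (fun n : ℕ => n.Coprime m),
            b n * (((((Finset.Icc 1 ⌊x⌋₊).filter fun t : ℕ =>
                ((m * n : ℕ) : ℤ) ∣ G.eval (t : ℤ)).card : ℕ) : ℝ) -
              (polyRootCountMod ![G] (m * n) : ℝ) * x / ((m * n : ℕ) : ℝ))| ≤ C * x ^ (1 - ε)) →
      ∀ᶠ y : ℝ in atTop, c * y ≤ (((Finset.Ioc ⌊y⌋₊ ⌊2 * y⌋₊).filter fun t : ℕ =>
          ∀ p : ℕ, p.Prime → (p : ℤ) ∣ G.eval (t : ℤ) → p ≤ t).card : ℝ) := by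
  -- the exponents, depending on `θ₀ = min θ (1/16)` only
  set θ₀ : ℝ := min θ (1 / 16) with hθ₀def
  have hθ₀ : 0 < θ₀ := lt_min hθ (by norm_num)
  have hθ₀' : θ₀ ≤ 1 / 16 := min_le_right _ _
  have hθ₀θ : θ₀ ≤ θ := min_le_left _ _
  set κ₁ : ℝ := θ₀ / 2 with hκ₁
  set κ₂ : ℝ := 4 * θ₀ / 5 with hκ₂
  set μ : ℝ := 1 - 12 * θ₀ / 25 with hμ
  set l₂ : ℝ := 1 - 21 * θ₀ / 50 with hl₂
  set ε : ℝ := θ₀ / 10 with hε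
  have hε0 : 0 < ε := by rw [hε]; positivity
  set mA : ℝ := Real.log (8 / 5) / 2 with hmA
  have hmA0 : 0 < mA := by rw [hmA]; exact div_pos (Real.log_pos (by norm_num)) two_pos
  have hμ0 : 0 < μ := by rw [hμ]; linarith
  have hμl : μ < l₂ := by rw [hμ, hl₂]; linarith
  set mB : ℝ := (Real.log l₂ - Real.log μ) / 2 with hmB
  have hmB0 : 0 < mB := by
    rw [hmB]; exact div_pos (by linarith [Real.log_lt_log hμ0 hμl]) two_pos
  set Nmax : ℝ := (6 / θ₀) ^ 2 with hNmax
  have hNmax0 : 0 < Nmax := by rw [hNmax]; positivity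
  refine ⟨mA * mB / (2 * Nmax), by positivity, fun G hdeg hirr HL => ?_⟩
  -- the inputs for this `G`
  obtain ⟨C₁', hC₁'⟩ := HL ε hε0
  set C₁ : ℝ := max C₁' 0 with hC₁def
  have hC₁0 : 0 ≤ C₁ := le_max_right _ _
  have hC₁ : ∀ (x : ℝ) (b : ℕ → ℝ), 2 ≤ x → (∀ n, |b n| ≤ 1) →
      (∀ n, ¬ Squarefree n → b n = 0) →
      ∑ m ∈ Finset.Ico 1 ⌈x ^ (1 - 4 * ε)⌉₊,
        |∑ n ∈ (Finset.Ico 1 ⌈x ^ (θ - ε)⌉₊).filter (fun n : ℕ => n.Coprime m),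
          b n * (((((Finset.Icc 1 ⌊x⌋₊).filter fun t : ℕ =>
              ((m * n : ℕ) : ℤ) ∣ G.eval (t : ℤ)).card : ℕ) : ℝ) -
            (polyRootCountMod ![G] (m * n) : ℝ) * x / ((m * n : ℕ) : ℝ))| ≤ C₁ * x ^ (1 - ε) :=
    fun x b hx hb1 hb2 => (hC₁' x b hx hb1 hb2).trans
      (mul_le_mul_of_nonneg_right (le_max_left _ _) (by positivity))
  obtain ⟨C₂, hC₂⟩ := exists_sum_range_polyRootCountMod_div_ge hdeg hirr
  set KG : ℝ := ((|G.coeff 2| + |G.coeff 1| + |G.coeff 0| : ℤ) : ℝ) with hKG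
  have ha0 : G.coeff 2 ≠ 0 := by
    intro h0
    have : G.leadingCoeff = 0 := by rw [Polynomial.leadingCoeff, hdeg, h0]
    rw [Polynomial.leadingCoeff_eq_zero] at this
    rw [this] at hdeg; simp at hdeg
  have hKG1 : 1 ≤ KG := by
    rw [hKG]; push_cast
    have : (1 : ℝ) ≤ |(G.coeff 2 : ℝ)| := by
      have h1 : (1 : ℤ) ≤ |G.coeff 2| := Int.one_le_abs ha0
      have h2 : ((1 : ℤ) : ℝ) ≤ ((|G.coeff 2| : ℤ) : ℝ) := by exact_mod_cast h1
      push_cast at h2; exact h2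
    linarith [abs_nonneg (G.coeff 1 : ℝ), abs_nonneg (G.coeff 0 : ℝ)]
  have hGK : ∀ t : ℕ, 1 ≤ t → (((G.eval (t : ℤ)).natAbs : ℕ) : ℝ) ≤ KG * (t : ℝ) ^ 2 :=
    fun t ht => natAbs_eval_le_of_natDegree_eq_two hdeg ht
  have hG0 : ∀ t : ℤ, G.eval t ≠ 0 := eval_ne_zero_of_irreducible hdeg hirr
  -- largeness conditions
  have e1 : ∀ᶠ y : ℝ in atTop, 4 * KG ≤ y := eventually_ge_atTop _
  have e2 : ∀ᶠ y : ℝ in atTop, 2 * KG ≤ y ^ (μ + κ₁ - 1) :=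
    (tendsto_rpow_atTop (by rw [hμ, hκ₁]; linarith)).eventually_ge_atTop _
  have e3 : ∀ᶠ y : ℝ in atTop, |(G.coeff 2 : ℝ)| + 2 ≤ y ^ κ₁ :=
    (tendsto_rpow_atTop (by rw [hκ₁]; positivity)).eventually_ge_atTop _
  have e4 : ∀ᶠ y : ℝ in atTop, 4 * |C₂| / (κ₁ * Real.log (8 / 5)) ≤ Real.log y :=
    Real.tendsto_log_atTop.eventually_ge_atTop _
  have e5 : ∀ᶠ y : ℝ in atTop, 4 * |C₂| / (μ * (Real.log l₂ - Real.log μ)) ≤ Real.log y :=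
    Real.tendsto_log_atTop.eventually_ge_atTop _
  have e6 : ∀ᶠ y : ℝ in atTop, 6 * C₁ / (mA * mB) ≤ y ^ ε :=
    (tendsto_rpow_atTop hε0).eventually_ge_atTop _
  filter_upwards [e1, e2, e3, e4, e5, e6] with y hy1 hy2 hy3 hy4 hy5 hy6
  -- basic facts about `y`
  have hy4 : 4 ≤ y := le_trans (by linarith only [hKG1]) hy1
  have hy0 : 0 < y := by linarith only [hy4]
  have hy1' : 1 < y := by linarith only [hy4]
  set L := Real.log y with hL
  have hL0 : 0 < L := Real.log_pos hy1'
  -- the two ranges of primes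
  set A : Finset ℕ := (Nat.primesLE ⌊y ^ κ₂⌋₊).filter (fun p : ℕ => y ^ κ₁ < (p : ℝ)) with hA
  set B : Finset ℕ := (Nat.primesLE ⌊y ^ l₂⌋₊).filter (fun p : ℕ => y ^ μ < (p : ℝ)) with hB
  -- exponent comparisons
  have hz1 : 1 < y ^ κ₁ := Real.one_lt_rpow hy1' (by rw [hκ₁]; positivity)
  have hz0 : 0 < y ^ κ₁ := by linarith only [hz1]
  have hκ₁κ₂ : y ^ κ₁ ≤ y ^ κ₂ :=
    Real.rpow_le_rpow_of_exponent_le hy1'.le (by rw [hκ₁, hκ₂]; linarith)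
  have hκ₂θ : y ^ κ₂ < y ^ (θ - ε) :=
    Real.rpow_lt_rpow_of_exponent_lt hy1' (by rw [hκ₂, hε]; linarith)
  have hθε2 : y ^ (θ - ε) ≤ (2 * y) ^ (θ - ε) :=
    Real.rpow_le_rpow hy0.le (by linarith) (by rw [hε]; linarith)
  have hl₂ε : y ^ l₂ < y ^ (1 - 4 * ε) :=
    Real.rpow_lt_rpow_of_exponent_lt hy1' (by rw [hl₂, hε]; linarith)
  have h4ε2 : y ^ (1 - 4 * ε) ≤ (2 * y) ^ (1 - 4 * ε) :=
    Real.rpow_le_rpow hy0.le (by linarith) (by rw [hε]; linarith)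
  have hκ₂μ : y ^ κ₂ ≤ y ^ μ :=
    Real.rpow_le_rpow_of_exponent_le hy1'.le (by rw [hκ₂, hμ]; linarith)
  have hκ₁μ : y ^ κ₁ ≤ y ^ μ :=
    Real.rpow_le_rpow_of_exponent_le hy1'.le (by rw [hκ₁, hμ]; linarith)
  have hμl₂ : y ^ μ ≤ y ^ l₂ := Real.rpow_le_rpow_of_exponent_le hy1'.le hμl.le
  have hl₂1 : y ^ l₂ ≤ y := by
    conv_rhs => rw [← Real.rpow_one y]
    exact Real.rpow_le_rpow_of_exponent_le hy1'.le (by rw [hl₂]; linarith)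
  have hκ₂1 : y ^ κ₂ ≤ y := by
    conv_rhs => rw [← Real.rpow_one y]
    exact Real.rpow_le_rpow_of_exponent_le hy1'.le (by rw [hκ₂]; linarith)
  have hμ2 : 2 ≤ y ^ μ := by linarith only [hy3, hκ₁μ, abs_nonneg (G.coeff 2 : ℝ)]
  have hprod : y ^ μ * y ^ κ₁ = y * y ^ (μ + κ₁ - 1) := by
    calc y ^ μ * y ^ κ₁ = y ^ (μ + κ₁) := (Real.rpow_add hy0 _ _).symm
      _ = y ^ ((1 : ℝ) + (μ + κ₁ - 1)) := by congr 1; ring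
      _ = y ^ (1 : ℝ) * y ^ (μ + κ₁ - 1) := Real.rpow_add hy0 _ _
      _ = y * y ^ (μ + κ₁ - 1) := by rw [Real.rpow_one]
  -- membership consequences
  have hmemA : ∀ n ∈ A, n.Prime ∧ y ^ κ₁ < n ∧ (n : ℝ) ≤ y ^ κ₂ := by
    intro n hn
    rw [hA, Finset.mem_filter, Nat.mem_primesLE] at hn
    refine ⟨hn.1.2, hn.2, ?_⟩
    have : (n : ℝ) ≤ ⌊y ^ κ₂⌋₊ := by exact_mod_cast hn.1.1
    exact this.trans (Nat.floor_le (by positivity))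
  have hmemB : ∀ m ∈ B, m.Prime ∧ y ^ μ < m ∧ (m : ℝ) ≤ y ^ l₂ := by
    intro m hm
    rw [hB, Finset.mem_filter, Nat.mem_primesLE] at hm
    refine ⟨hm.1.2, hm.2, ?_⟩
    have : (m : ℝ) ≤ ⌊y ^ l₂⌋₊ := by exact_mod_cast hm.1.1
    exact this.trans (Nat.floor_le (by positivity))
  have hlt_ceil : ∀ {n : ℕ} {r : ℝ}, (n : ℝ) < r → n < ⌈r⌉₊ := fun {n r} h => by
    have : (n : ℝ) < ⌈r⌉₊ := h.trans_le (Nat.le_ceil r)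
    exact_mod_cast this
  have hAhyp : ∀ n ∈ A, n.Prime ∧ n < ⌈y ^ (θ - ε)⌉₊ ∧ n < ⌈(2 * y) ^ (θ - ε)⌉₊ := fun n hn =>
    ⟨(hmemA n hn).1, hlt_ceil ((hmemA n hn).2.2.trans_lt hκ₂θ),
      hlt_ceil (((hmemA n hn).2.2.trans_lt hκ₂θ).trans_le hθε2)⟩
  have hBhyp : ∀ m ∈ B, 1 ≤ m ∧ m < ⌈y ^ (1 - 4 * ε)⌉₊ ∧ m < ⌈(2 * y) ^ (1 - 4 * ε)⌉₊ :=
    fun m hm => ⟨(hmemB m hm).1.one_lt.le, hlt_ceil ((hmemB m hm).2.2.trans_lt hl₂ε),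
      hlt_ceil (((hmemB m hm).2.2.trans_lt hl₂ε).trans_le h4ε2)⟩
  have hABcop : ∀ n ∈ A, ∀ m ∈ B, n.Coprime m := by
    intro n hn m hm
    rw [Nat.coprime_primes (hmemA n hn).1 (hmemB m hm).1]
    intro hnm
    have h1 := (hmemA n hn).2.2
    have h2 := (hmemB m hm).2.1
    rw [hnm] at h1
    linarith only [h1, h2, hκ₂μ]
  -- (i) lower bound from the level of distribution at `y` and `2y`
  have hlow := sum_sum_card_window_ge_of_level G hy0.le
    (hC₁ y · (by linarith)) (hC₁ (2 * y) · (by linarith)) hAhyp hBhyp hABcop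
  -- (ii) Mertens on the two ranges
  have hlogpow : ∀ {ν : ℝ}, 0 < ν → Real.log (Real.log (y ^ ν)) = Real.log ν + Real.log L := by
    intro ν hν
    rw [Real.log_rpow hy0, Real.log_mul hν.ne' hL0.ne']
  have hSA : mA ≤ ∑ p ∈ A, (polyRootCountMod ![G] p : ℝ) / p := by
    have hu2 : 2 ≤ y ^ κ₁ := by linarith only [hy3, abs_nonneg (G.coeff 2 : ℝ)]
    have hua : |(G.coeff 2 : ℝ)| < y ^ κ₁ := by linarith only [hy3]
    have h := hC₂ (y ^ κ₁) (y ^ κ₂) hu2 hua hκ₁κ₂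
    have hκ₁0 : 0 < κ₁ := by rw [hκ₁]; positivity
    have hκ₂0 : 0 < κ₂ := by rw [hκ₂]; positivity
    rw [hlogpow hκ₁0, hlogpow hκ₂0, Real.log_rpow hy0] at h
    have hratio : Real.log κ₂ - Real.log κ₁ = Real.log (8 / 5) := by
      rw [← Real.log_div hκ₂0.ne' hκ₁0.ne']
      congr 1
      rw [hκ₁, hκ₂]; field_simp; ring
    refine le_trans ?_ h
    -- `mA = log(8/5)/2 ≤ log(8/5) − 2C₂/(κ₁ L)` from `hy4`
    have hκL : 0 < κ₁ * L := by positivity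
    have hb : 2 * C₂ / (κ₁ * L) ≤ Real.log (8 / 5) / 2 := by
      rw [div_le_iff₀ hκL]
      have h85 : 0 < Real.log (8 / 5) := Real.log_pos (by norm_num)
      have := (div_le_iff₀ (by positivity : 0 < κ₁ * Real.log (8 / 5))).mp hy4
      linarith only [this, le_abs_self C₂]
    rw [hmA]
    linarith only [hratio, hb]
  have hSB : mB ≤ ∑ p ∈ B, (polyRootCountMod ![G] p : ℝ) / p := by
    have hua : |(G.coeff 2 : ℝ)| < y ^ μ := by linarith only [hy3, hκ₁μ]
    have h := hC₂ (y ^ μ) (y ^ l₂) hμ2 hua hμl₂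
    have hl₂0 : 0 < l₂ := by linarith
    rw [hlogpow hμ0, hlogpow hl₂0, Real.log_rpow hy0] at h
    refine le_trans ?_ h
    have hμL : 0 < μ * L := by positivity
    have hlog0 : 0 < Real.log l₂ - Real.log μ := by linarith [Real.log_lt_log hμ0 hμl]
    have hb : 2 * C₂ / (μ * L) ≤ (Real.log l₂ - Real.log μ) / 2 := by
      rw [div_le_iff₀ hμL]
      have := (div_le_iff₀ (by positivity : 0 < μ * (Real.log l₂ - Real.log μ))).mp hy5
      linarith only [this, le_abs_self C₂]
    rw [hmB]
    linarith only [hb]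
  have hSB0 : 0 ≤ ∑ p ∈ B, (polyRootCountMod ![G] p : ℝ) / p := by linarith only [hSB, hmB0]
  have hmain : mA * mB * y ≤ y * (∑ p ∈ B, (polyRootCountMod ![G] p : ℝ) / p) *
      (∑ p ∈ A, (polyRootCountMod ![G] p : ℝ) / p) := by
    have : y * mB * mA ≤ y * (∑ p ∈ B, (polyRootCountMod ![G] p : ℝ) / p) *
        (∑ p ∈ A, (polyRootCountMod ![G] p : ℝ) / p) :=
      mul_le_mul (mul_le_mul_of_nonneg_left hSB hy0.le) hSA hmA0.le (by positivity)
    linarith only [this]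
  -- (iii) the error term
  have herr : C₁ * (2 * y) ^ (1 - ε) + C₁ * y ^ (1 - ε) ≤ mA * mB / 2 * y := by
    have hcomb : y ^ ε * y ^ (1 - ε) = y := by
      rw [← Real.rpow_add hy0]; norm_num
    have hye0 : 0 ≤ y ^ (1 - ε) := by positivity
    have h2y : (2 * y) ^ (1 - ε) ≤ 2 * y ^ (1 - ε) := by
      rw [Real.mul_rpow (by norm_num) hy0.le]
      have : (2 : ℝ) ^ (1 - ε) ≤ 2 := by
        conv_rhs => rw [← Real.rpow_one 2]
        exact Real.rpow_le_rpow_of_exponent_le (by norm_num) (by linarith only [hε0])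
      exact mul_le_mul_of_nonneg_right this hye0
    have hmm : 0 < mA * mB := by positivity
    have h2yC := mul_le_mul_of_nonneg_left h2y hC₁0
    calc C₁ * (2 * y) ^ (1 - ε) + C₁ * y ^ (1 - ε)
        ≤ 3 * C₁ * y ^ (1 - ε) := by linarith only [h2yC]
      _ ≤ (mA * mB / 2 * y ^ ε) * y ^ (1 - ε) := by
          apply mul_le_mul_of_nonneg_right _ hye0
          have := (div_le_iff₀ hmm).mp hy6
          linarith only [this]
      _ = mA * mB / 2 * y := by rw [mul_assoc, hcomb]
  -- (iv) upper bound by the smooth count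
  have hA' : ∀ n ∈ A, n.Prime ∧ y ^ κ₁ < n ∧ (n : ℝ) ≤ y := fun n hn =>
    ⟨(hmemA n hn).1, (hmemA n hn).2.1, (hmemA n hn).2.2.trans hκ₂1⟩
  have hB' : ∀ m ∈ B, m.Prime ∧ y ^ κ₁ < m ∧ (m : ℝ) ≤ y := fun m hm =>
    ⟨(hmemB m hm).1, by linarith only [(hmemB m hm).2.1, hκ₁μ], (hmemB m hm).2.2.trans hl₂1⟩
  have hbig : ∀ m ∈ B, ∀ n ∈ A, 2 * KG * y < (m : ℝ) * n := by
    intro m hm n hn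
    have h1 := (hmemB m hm).2.1
    have h2 := (hmemA n hn).2.1
    calc 2 * KG * y ≤ y ^ (μ + κ₁ - 1) * y := mul_le_mul_of_nonneg_right hy2 hy0.le
      _ = y ^ μ * y ^ κ₁ := by rw [hprod]; ring
      _ < (m : ℝ) * n := mul_lt_mul'' h1 h2 (by positivity) hz0.le
  have hM : ∀ t : ℕ, ⌊y⌋₊ < t → t ≤ ⌊2 * y⌋₊ →
      (((G.eval (t : ℤ)).natAbs : ℕ) : ℝ) ≤ 4 * KG * y ^ 2 := by
    intro t ht1 ht2
    have ht : 1 ≤ t := by omega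
    have ht2y : (t : ℝ) ≤ 2 * y := by
      have : (t : ℝ) ≤ ⌊2 * y⌋₊ := by exact_mod_cast ht2
      exact this.trans (Nat.floor_le (by linarith))
    refine (hGK t ht).trans ?_
    have ht0 : (0 : ℝ) ≤ t := Nat.cast_nonneg t
    have htt : (t : ℝ) ^ 2 ≤ (2 * y) ^ 2 := pow_le_pow_left₀ ht0 ht2y 2
    calc KG * (t : ℝ) ^ 2 ≤ KG * (2 * y) ^ 2 := mul_le_mul_of_nonneg_left htt (by linarith only [hKG1])
      _ = 4 * KG * y ^ 2 := by ring
  have hup := sum_sum_card_window_le_smooth G (by linarith) hGK hG0 (by linarith) hz1 hM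
    hA' hB' hbig
  have hratio : (Real.log (4 * KG * y ^ 2) / Real.log (y ^ κ₁)) ^ 2 ≤ Nmax := by
    rw [Real.log_rpow hy0]
    have hy3 : 4 * KG * y ^ 2 ≤ y ^ 3 := by
      have : 4 * KG * y ^ 2 ≤ y * y ^ 2 := mul_le_mul_of_nonneg_right hy1 (sq_nonneg y)
      exact this.trans_eq (by ring)
    have hlog3 : Real.log (y ^ 3) = 3 * L := by
      rw [Real.log_pow]; push_cast; ring
    have hMlog : Real.log (4 * KG * y ^ 2) ≤ 3 * L := by
      rw [← hlog3]; exact Real.log_le_log (by positivity) hy3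
    have hM1 : 1 ≤ 4 * KG * y ^ 2 :=
      one_le_mul_of_one_le_of_one_le (by linarith only [hKG1]) (one_le_pow₀ hy1'.le)
    have hr0 : 0 ≤ Real.log (4 * KG * y ^ 2) / (κ₁ * L) :=
      div_nonneg (Real.log_nonneg hM1) (by positivity)
    have hr : Real.log (4 * KG * y ^ 2) / (κ₁ * L) ≤ 6 / θ₀ := by
      rw [div_le_iff₀ (by positivity)]
      have : 6 / θ₀ * (κ₁ * L) = 3 * L := by rw [hκ₁]; field_simp; ring
      rw [this]; exact hMlog
    rw [hNmax]
    exact pow_le_pow_left₀ hr0 hr 2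
  -- (v) combine
  have hcard0 : 0 ≤ (((Finset.Ioc ⌊y⌋₊ ⌊2 * y⌋₊).filter fun t : ℕ =>
      ∀ p : ℕ, p.Prime → (p : ℤ) ∣ G.eval (t : ℤ) → p ≤ t).card : ℝ) := Nat.cast_nonneg _
  have hrc := mul_le_mul_of_nonneg_right hratio hcard0
  have hchain : mA * mB / 2 * y ≤ Nmax * (((Finset.Ioc ⌊y⌋₊ ⌊2 * y⌋₊).filter fun t : ℕ =>
      ∀ p : ℕ, p.Prime → (p : ℤ) ∣ G.eval (t : ℤ) → p ≤ t).card : ℝ) := by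
    linarith only [hlow, hup, hmain, herr, hrc]
  have : mA * mB / (2 * Nmax) * y = (mA * mB / 2 * y) / Nmax := by
    field_simp
  rw [this, div_le_iff₀ hNmax0]
  linarith only [hchain]

/-- **Positive lower density of `t`-smooth values from the level hypothesis** (the `q = 1` form):
with the constant `c(θ)` of `exists_const_of_level`, for every quadratic `G` irreducible over `ℚ`
with the level of distribution of inner exponent `θ`, `#{1 ≤ t ≤ X : G(t) is t-smooth} ≥ (c/2) X`
for all large `X` (take `y = X/2`). [cite: Teravainen2024, Proposition 2.11 (q = 1, conditional form)] -/
theorem exists_const_forall_large_of_level (θ : ℝ) (hθ : 0 < θ) :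
    ∃ c : ℝ, 0 < c ∧ ∀ G : ℤ[X], G.natDegree = 2 → Irreducible (G.map (Int.castRingHom ℚ)) →
      (∀ ε : ℝ, 0 < ε → ∃ C : ℝ, ∀ (x : ℝ) (b : ℕ → ℝ), 2 ≤ x → (∀ n, |b n| ≤ 1) →
        (∀ n, ¬ Squarefree n → b n = 0) →
        ∑ m ∈ Finset.Ico 1 ⌈x ^ (1 - 4 * ε)⌉₊,
          |∑ n ∈ (Finset.Ico 1 ⌈x ^ (θ - ε)⌉₊).filter (fun n : ℕ => n.Coprime m),
            b n * (((((Finset.Icc 1 ⌊x⌋₊).filter fun t : ℕ =>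
                ((m * n : ℕ) : ℤ) ∣ G.eval (t : ℤ)).card : ℕ) : ℝ) -
              (polyRootCountMod ![G] (m * n) : ℝ) * x / ((m * n : ℕ) : ℝ))| ≤ C * x ^ (1 - ε)) →
      ∃ X₀ : ℕ, ∀ X : ℕ, X₀ ≤ X → c * (X : ℝ) ≤ (((Finset.Icc 1 X).filter fun t : ℕ =>
          ∀ p : ℕ, p.Prime → (p : ℤ) ∣ G.eval (t : ℤ) → p ≤ t).card : ℝ) := by
  obtain ⟨c, hc, hcore⟩ := exists_const_of_level θ hθ
  refine ⟨c / 2, by positivity, fun G hdeg hirr HL => ?_⟩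
  have hT : Tendsto (fun X : ℕ => (X : ℝ) / 2) atTop atTop :=
    tendsto_natCast_atTop_atTop.atTop_div_const (by norm_num)
  obtain ⟨X₀, hX₀⟩ := eventually_atTop.mp (hT.eventually (hcore G hdeg hirr HL))
  refine ⟨X₀, fun X hX => ?_⟩
  have h := hX₀ X hX
  have hfloor : ⌊2 * ((X : ℝ) / 2)⌋₊ = X := by
    rw [mul_div_cancel₀ _ (two_ne_zero' ℝ), Nat.floor_natCast]
  rw [hfloor] at h
  have hsub : ((Finset.Ioc ⌊(X : ℝ) / 2⌋₊ X).filter fun t : ℕ =>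
      ∀ p : ℕ, p.Prime → (p : ℤ) ∣ G.eval (t : ℤ) → p ≤ t) ⊆
      ((Finset.Icc 1 X).filter fun t : ℕ =>
        ∀ p : ℕ, p.Prime → (p : ℤ) ∣ G.eval (t : ℤ) → p ≤ t) := by
    refine Finset.filter_subset_filter _ fun t ht => ?_
    rw [Finset.mem_Ioc] at ht
    rw [Finset.mem_Icc]
    omega
  have hcard : (((Finset.Ioc ⌊(X : ℝ) / 2⌋₊ X).filter fun t : ℕ =>
      ∀ p : ℕ, p.Prime → (p : ℤ) ∣ G.eval (t : ℤ) → p ≤ t).card : ℝ) ≤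
      (((Finset.Icc 1 X).filter fun t : ℕ =>
        ∀ p : ℕ, p.Prime → (p : ℤ) ∣ G.eval (t : ℤ) → p ≤ t).card : ℝ) := by
    exact_mod_cast Finset.card_le_card hsub
  linarith

/-! ### E. Property S for an irreducible quadratic from the level hypothesis on its progressions -/

/-- The substituted polynomial `P(qX + b)` is again a quadratic. [folklore] -/
theorem natDegree_comp_linear {P : ℤ[X]} (hdeg : P.natDegree = 2) {q : ℕ} (hq : 1 ≤ q) (b : ℕ) :
    (P.comp (C (q : ℤ) * X + C (b : ℤ))).natDegree = 2 := by
  have hq0 : (q : ℤ) ≠ 0 := by exact_mod_cast (by omega : q ≠ 0)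
  rw [Polynomial.natDegree_comp, hdeg, Polynomial.natDegree_add_C, Polynomial.natDegree_C_mul_X _ hq0]

/-- The leading coefficient of `P(qX + b)` is `a q²`. [folklore] -/
theorem leadingCoeff_comp_linear {P : ℤ[X]} (hdeg : P.natDegree = 2) {q : ℕ} (hq : 1 ≤ q)
    (b : ℕ) : (P.comp (C (q : ℤ) * X + C (b : ℤ))).leadingCoeff = P.leadingCoeff * (q : ℤ) ^ 2 := by
  have hq0 : (q : ℤ) ≠ 0 := by exact_mod_cast (by omega : q ≠ 0)
  have hlin : (C (q : ℤ) * X + C (b : ℤ)).natDegree = 1 := by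
    rw [Polynomial.natDegree_add_C, Polynomial.natDegree_C_mul_X _ hq0]
  rw [Polynomial.leadingCoeff_comp (by rw [hlin]; norm_num), hdeg]
  congr 1
  rw [Polynomial.leadingCoeff, hlin]
  simp

/-- `P(qX + b)` is irreducible over `ℚ` when the quadratic `P` is: a rational root `r` of the
former gives the rational root `qr + b` of the latter. [folklore] -/
theorem irreducible_map_comp_linear {P : ℤ[X]} (hdeg : P.natDegree = 2)
    (hirr : Irreducible (P.map (Int.castRingHom ℚ))) {q : ℕ} (hq : 1 ≤ q) (b : ℕ) :
    Irreducible ((P.comp (C (q : ℤ) * X + C (b : ℤ))).map (Int.castRingHom ℚ)) := by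
  set G := P.comp (C (q : ℤ) * X + C (b : ℤ)) with hG
  have hGdeg : (G.map (Int.castRingHom ℚ)).natDegree = 2 := by
    rw [Polynomial.natDegree_map_eq_of_injective Int.cast_injective, natDegree_comp_linear hdeg hq b]
  have hPdeg : (P.map (Int.castRingHom ℚ)).natDegree = 2 := by
    rw [Polynomial.natDegree_map_eq_of_injective Int.cast_injective, hdeg]
  rw [Polynomial.irreducible_iff_roots_eq_zero_of_degree_le_three (by omega) (by omega),
    Multiset.eq_zero_iff_forall_notMem]
  intro r hr
  have hG0 : G.map (Int.castRingHom ℚ) ≠ 0 := by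
    intro h0; rw [h0, Polynomial.natDegree_zero] at hGdeg; omega
  have hroot : (G.map (Int.castRingHom ℚ)).IsRoot r := (Polynomial.mem_roots hG0).mp hr
  have hProot : (P.map (Int.castRingHom ℚ)).IsRoot ((q : ℚ) * r + b) := by
    rw [Polynomial.IsRoot] at hroot ⊢
    rw [hG, Polynomial.map_comp, Polynomial.eval_comp] at hroot
    simpa using hroot
  have h1 := Polynomial.degree_eq_one_of_irreducible_of_root hirr hProot
  have h2 : (P.map (Int.castRingHom ℚ)).degree = 2 := by
    rw [Polynomial.degree_eq_natDegree, hPdeg]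
    · rfl
    · intro h; rw [h, Polynomial.natDegree_zero] at hPdeg; omega
  rw [h2] at h1
  exact absurd h1 (by decide)

/-- **Property S for a quadratic irreducible over `ℚ` from the level of distribution of its
progression-polynomials.**  If for some `θ > 0` every `G = P(qX + b)` (`q, b ≥ 1`) satisfies the
Iwaniec-type bilinear level of distribution with inner exponent `θ` (see
`exists_const_of_level`), then `P` has property S: with the constant `c(θ)` of
`exists_const_of_level`, `η₀ = c/4`, since the `t ∈ (y, 2y]`, `2y = (x − b)/q`, with `G(t)`
`t`-smooth inject (`t ↦ qt + b`) into the `n ≤ x`, `n ≡ b (mod q)` with `P(n)` `n`-smooth.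
This isolates exactly what the tree lacks for `teravainen2024_prop_2_11_quadratic`: the level of
distribution beyond `x` for general quadratics (in the tree only for `X² + 1`,
`Iwaniec1978.proposition1_corollary_holds`). [cite: Teravainen2024, Proposition 2.11 and §7] -/
theorem hasPropertyS_of_level {P : ℤ[X]} (hdeg : P.natDegree = 2)
    (hirr : Irreducible (P.map (Int.castRingHom ℚ))) {θ : ℝ} (hθ : 0 < θ)
    (H : ∀ q b : ℕ, 1 ≤ q → 1 ≤ b →
      ∀ ε : ℝ, 0 < ε → ∃ K : ℝ, ∀ (x : ℝ) (coef : ℕ → ℝ), 2 ≤ x → (∀ n, |coef n| ≤ 1) →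
        (∀ n, ¬ Squarefree n → coef n = 0) →
        ∑ m ∈ Finset.Ico 1 ⌈x ^ (1 - 4 * ε)⌉₊,
          |∑ n ∈ (Finset.Ico 1 ⌈x ^ (θ - ε)⌉₊).filter (fun n : ℕ => n.Coprime m),
            coef n * (((((Finset.Icc 1 ⌊x⌋₊).filter fun t : ℕ =>
                ((m * n : ℕ) : ℤ) ∣ (P.comp (C (q : ℤ) * X + C (b : ℤ))).eval (t : ℤ)).card :
                  ℕ) : ℝ) -
              (polyRootCountMod ![P.comp (C (q : ℤ) * X + C (b : ℤ))] (m * n) : ℝ) * x /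
                ((m * n : ℕ) : ℝ))| ≤ K * x ^ (1 - ε)) :
    HasPropertyS P := by
  obtain ⟨c, hc, hcore⟩ := exists_const_of_level θ hθ
  refine ⟨c / 4, by positivity, fun q b hq hb η hη => ?_⟩
  set G := P.comp (C (q : ℤ) * X + C (b : ℤ)) with hG
  have hwin := hcore G (natDegree_comp_linear hdeg hq b) (irreducible_map_comp_linear hdeg hirr hq b)
    (H q b hq hb)
  have hq0 : (0 : ℝ) < q := by exact_mod_cast (by omega : 0 < q)
  -- pass to `x : ℕ` with `y = (x − b)/(2q)`
  have hT : Tendsto (fun x : ℕ => ((x : ℝ) - b) / (2 * q)) atTop atTop := by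
    refine Tendsto.atTop_div_const (by positivity) ?_
    exact (tendsto_atTop_add_const_right _ (-(b : ℝ)) tendsto_natCast_atTop_atTop).congr
      fun x => by ring
  have hev := hT.eventually hwin
  have hx2b : ∀ᶠ x : ℕ in atTop, 2 * b ≤ x := eventually_ge_atTop _
  obtain ⟨x₀, hx₀⟩ := eventually_atTop.mp (hev.and hx2b)
  refine ⟨x₀, fun x hx => ?_⟩
  obtain ⟨hwx, hxb⟩ := hx₀ x hx
  set y : ℝ := ((x : ℝ) - b) / (2 * q) with hy
  -- the injection `t ↦ q t + b`
  have hb0 : (0 : ℝ) ≤ b := Nat.cast_nonneg b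
  have hxb' : (2 * b : ℝ) ≤ x := by exact_mod_cast hxb
  have hy0 : 0 ≤ y := by rw [hy]; exact div_nonneg (by linarith) (by positivity)
  have hy2 : 2 * y = ((x : ℝ) - b) / q := by rw [hy]; field_simp
  have hmaps : Set.MapsTo (fun t : ℕ => b + q * t)
      (((Finset.Ioc ⌊y⌋₊ ⌊2 * y⌋₊).filter fun t : ℕ =>
        ∀ p : ℕ, p.Prime → (p : ℤ) ∣ G.eval (t : ℤ) → p ≤ t) : Set ℕ)
      (((Finset.Icc 1 x).filter (fun n : ℕ =>
        n % q = b % q ∧ ∀ p : ℕ, p.Prime → (p : ℤ) ∣ P.eval (n : ℤ) → p ≤ n)) : Set ℕ) := by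
    intro t ht
    rw [Finset.mem_coe, Finset.mem_filter, Finset.mem_Ioc] at ht
    obtain ⟨⟨_, ht2⟩, hsm⟩ := ht
    dsimp only
    rw [Finset.mem_coe, Finset.mem_filter, Finset.mem_Icc]
    have htx : b + q * t ≤ x := by
      have h1 : (t : ℝ) ≤ ⌊2 * y⌋₊ := by exact_mod_cast ht2
      have hfl : (⌊2 * y⌋₊ : ℝ) ≤ 2 * y := Nat.floor_le (by linarith)
      have h2 : (t : ℝ) ≤ ((x : ℝ) - b) / q := by rw [← hy2]; exact h1.trans hfl
      have h3 : (q : ℝ) * t ≤ (x : ℝ) - b := by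
        rwa [le_div_iff₀ hq0, mul_comm] at h2
      have h4 : ((b + q * t : ℕ) : ℝ) ≤ x := by push_cast; linarith
      exact_mod_cast h4
    refine ⟨⟨by omega, htx⟩, by rw [Nat.add_mul_mod_self_left], fun p hp hpd => ?_⟩
    have heval : P.eval ((b + q * t : ℕ) : ℤ) = G.eval (t : ℤ) := by
      rw [hG, Polynomial.eval_comp]
      simp only [Polynomial.eval_add, Polynomial.eval_mul, Polynomial.eval_C,
        Polynomial.eval_X]
      push_cast
      ring_nf
    rw [heval] at hpd
    have := hsm p hp hpd
    nlinarith
  have hinjOn : Set.InjOn (fun t : ℕ => b + q * t)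
      (((Finset.Ioc ⌊y⌋₊ ⌊2 * y⌋₊).filter fun t : ℕ =>
        ∀ p : ℕ, p.Prime → (p : ℤ) ∣ G.eval (t : ℤ) → p ≤ t) : Set ℕ) := by
    intro t₁ _ t₂ _ h
    have : q * t₁ = q * t₂ := by simpa using h
    exact Nat.eq_of_mul_eq_mul_left (by omega) this
  have hinj : (((Finset.Ioc ⌊y⌋₊ ⌊2 * y⌋₊).filter fun t : ℕ =>
      ∀ p : ℕ, p.Prime → (p : ℤ) ∣ G.eval (t : ℤ) → p ≤ t).card : ℝ) ≤
      (((Finset.Icc 1 x).filter (fun n : ℕ =>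
        n % q = b % q ∧ ∀ p : ℕ, p.Prime → (p : ℤ) ∣ P.eval (n : ℤ) → p ≤ n)).card : ℝ) := by
    exact_mod_cast Finset.card_le_card_of_injOn _ hmaps hinjOn
  -- the count
  have hyx : (x : ℝ) / (4 * q) ≤ y := by
    rw [hy, div_le_div_iff₀ (by positivity) (by positivity)]
    nlinarith [hxb', hq0, hb0]
  have hx0 : (0 : ℝ) ≤ x := Nat.cast_nonneg x
  have hηc : η ≤ c / 4 / q := hη.le
  calc η * (x : ℝ) ≤ c / 4 / q * x := mul_le_mul_of_nonneg_right hηc hx0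
    _ = c * (x / (4 * q)) := by field_simp
    _ ≤ c * y := mul_le_mul_of_nonneg_left hyx hc.le
    _ ≤ _ := hwx
    _ ≤ _ := hinj

/-! ### F. The hypothesis holds for `X² + 1` (Iwaniec's Corollary), so it is the right shape -/

/-- **The level hypothesis of `exists_const_of_level` / `hasPropertyS_of_level` is, for
`G = X² + 1` and `θ = 1/15`, literally Iwaniec's Corollary of Proposition 1** (PROVED in the
tree, `Iwaniec1978.proposition1_corollary_holds`): the congruence count
`#{1 ≤ t ≤ x : d ∣ t² + 1}` is Iwaniec's `congrCount x d` and `polyRootCountMod ![X² + 1] = ρ`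
(`Iwaniec1978.rho_eq_polyRootCountMod`).  In particular the hypothesis is not vacuous.
[cite: IwaniecInventiones1978, Corollary p. 176] -/
theorem level_X_sq_add_one (ε : ℝ) (hε : 0 < ε) :
    ∃ C : ℝ, ∀ (x : ℝ) (b : ℕ → ℝ), 2 ≤ x → (∀ n, |b n| ≤ 1) →
      (∀ n, ¬ Squarefree n → b n = 0) →
      ∑ m ∈ Finset.Ico 1 ⌈x ^ (1 - 4 * ε)⌉₊,
        |∑ n ∈ (Finset.Ico 1 ⌈x ^ (1 / 15 - ε)⌉₊).filter (fun n : ℕ => n.Coprime m),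
          b n * (((((Finset.Icc 1 ⌊x⌋₊).filter fun t : ℕ =>
              ((m * n : ℕ) : ℤ) ∣ (X ^ 2 + 1 : ℤ[X]).eval (t : ℤ)).card : ℕ) : ℝ) -
            (polyRootCountMod ![(X ^ 2 + 1 : ℤ[X])] (m * n) : ℝ) * x / ((m * n : ℕ) : ℝ))| ≤
        C * x ^ (1 - ε) := by
  obtain ⟨C, hC⟩ := Iwaniec1978.proposition1_corollary_holds ε hε
  refine ⟨C, fun x b hx hb1 hb2 => ?_⟩
  have key : ∀ d : ℕ, (((((Finset.Icc 1 ⌊x⌋₊).filter fun t : ℕ =>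
      (d : ℤ) ∣ (X ^ 2 + 1 : ℤ[X]).eval (t : ℤ)).card : ℕ) : ℝ) -
      (polyRootCountMod ![(X ^ 2 + 1 : ℤ[X])] d : ℝ) * x / (d : ℝ)) = Iwaniec1978.rem x d := by
    intro d
    unfold Iwaniec1978.rem Iwaniec1978.congrCount
    rw [Iwaniec1978.rho_eq_polyRootCountMod]
    congr 3
    refine Finset.filter_congr fun t _ => ?_
    simp only [Polynomial.eval_add, Polynomial.eval_pow, Polynomial.eval_X, Polynomial.eval_one]
    exact_mod_cast (Int.natCast_dvd_natCast (m := d) (n := t ^ 2 + 1))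
  have hsum : ∀ m : ℕ, ∑ n ∈ (Finset.Ico 1 ⌈x ^ (1 / 15 - ε)⌉₊).filter (fun n : ℕ => n.Coprime m),
      b n * (((((Finset.Icc 1 ⌊x⌋₊).filter fun t : ℕ =>
          ((m * n : ℕ) : ℤ) ∣ (X ^ 2 + 1 : ℤ[X]).eval (t : ℤ)).card : ℕ) : ℝ) -
        (polyRootCountMod ![(X ^ 2 + 1 : ℤ[X])] (m * n) : ℝ) * x / ((m * n : ℕ) : ℝ)) =
      Iwaniec1978.bilinearB x b m (x ^ (1 / 15 - ε)) := by
    intro m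
    unfold Iwaniec1978.bilinearB
    refine Finset.sum_congr rfl fun n _ => ?_
    rw [key (m * n)]
  simp_rw [hsum]
  exact hC x b hx hb1 hb2

/-! ### G. The named fact from a uniform level of distribution for irreducible quadratics -/

/-- **Teräväinen 2024, Proposition 2.11 (quadratic clause) reduces to a level of distribution
beyond `x` for quadratics irreducible over `ℚ`.**  If there is `θ > 0` such that every quadratic
`G ∈ ℤ[X]` with positive leading coefficient and irreducible over `ℚ` satisfies the Iwaniec-type
bilinear level of distribution with inner exponent `θ` (the general-`G` counterpart of
`Iwaniec1978.proposition1_corollary`, cf. Lemke Oliver 2012, §2; for `G = X² + 1`, `θ = 1/15`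
it is `level_X_sq_add_one`), then `teravainen2024_prop_2_11_quadratic` holds: reducible
quadratics by `teravainen2024_prop_2_11_quadratic_of_irreducible`, irreducible ones by
`hasPropertyS_of_level` applied to the family `P(qX + b)` (again quadratics with positive leading
coefficient `aq²`, irreducible over `ℚ`).  What is NOT in the tree is exactly this hypothesis for
`G ≠ X² + 1`. [cite: Teravainen2024, Proposition 2.11 and §7] -/
theorem teravainen2024_prop_2_11_quadratic_of_level
    (H : ∃ θ : ℝ, 0 < θ ∧ ∀ G : ℤ[X], G.natDegree = 2 → 0 < G.leadingCoeff →
      Irreducible (G.map (Int.castRingHom ℚ)) →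
      ∀ ε : ℝ, 0 < ε → ∃ K : ℝ, ∀ (x : ℝ) (coef : ℕ → ℝ), 2 ≤ x → (∀ n, |coef n| ≤ 1) →
        (∀ n, ¬ Squarefree n → coef n = 0) →
        ∑ m ∈ Finset.Ico 1 ⌈x ^ (1 - 4 * ε)⌉₊,
          |∑ n ∈ (Finset.Ico 1 ⌈x ^ (θ - ε)⌉₊).filter (fun n : ℕ => n.Coprime m),
            coef n * (((((Finset.Icc 1 ⌊x⌋₊).filter fun t : ℕ =>
                ((m * n : ℕ) : ℤ) ∣ G.eval (t : ℤ)).card : ℕ) : ℝ) -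
              (polyRootCountMod ![G] (m * n) : ℝ) * x / ((m * n : ℕ) : ℝ))| ≤ K * x ^ (1 - ε)) :
    teravainen2024_prop_2_11_quadratic := by
  obtain ⟨θ, hθ, Hθ⟩ := H
  refine teravainen2024_prop_2_11_quadratic_of_irreducible fun P hdeg hlc hirr => ?_
  refine hasPropertyS_of_level hdeg hirr hθ fun q b hq hb => ?_
  refine Hθ _ (natDegree_comp_linear hdeg hq b) ?_ (irreducible_map_comp_linear hdeg hirr hq b)
  rw [leadingCoeff_comp_linear hdeg hq b]
  have : (0 : ℤ) < (q : ℤ) ^ 2 := by positivity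
  positivity

/-! ### H. The hypothesis in the tree's vocabulary: `Iwaniec1978.proposition1G_corollary` -/

/-- A quadratic is the `quadPoly` of its three coefficients. [folklore] -/
theorem eq_quadPoly_of_natDegree_eq_two {G : ℤ[X]} (hdeg : G.natDegree = 2) :
    G = Iwaniec1978.quadPoly (G.coeff 2) (G.coeff 1) (G.coeff 0) := by
  conv_lhs => rw [Polynomial.as_sum_range_C_mul_X_pow G, hdeg]
  simp [Finset.sum_range_succ, Iwaniec1978.quadPoly]
  ring

/-- The congruence count of this file for `G = quadPoly a b c` is the tree's `congrCountG`
(`(d : ℤ) ∣ G(t) ↔ d ∣ |G(t)|`). [folklore] -/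
theorem card_filter_dvd_eval_quadPoly_eq_congrCountG (a b c : ℤ) (x : ℝ) (d : ℕ) :
    ((Finset.Icc 1 ⌊x⌋₊).filter fun t : ℕ =>
        (d : ℤ) ∣ (Iwaniec1978.quadPoly a b c).eval (t : ℤ)).card =
      Iwaniec1978.congrCountG a b c x d := by
  unfold Iwaniec1978.congrCountG Iwaniec1978.gAbs
  congr 1
  refine Finset.filter_congr fun t _ => ?_
  rw [Iwaniec1978.eval_quadPoly]
  exact Int.natCast_dvd

/-- **`Iwaniec1978.proposition1G_corollary a b c` is the level hypothesis of this file for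
`G = quadPoly a b c` with `θ = 1/15`.** [cite: IwaniecInventiones1978, Corollary p. 176] -/
theorem level_of_proposition1G_corollary {a b c : ℤ} (h : Iwaniec1978.proposition1G_corollary a b c)
    (ε : ℝ) (hε : 0 < ε) :
    ∃ K : ℝ, ∀ (x : ℝ) (coef : ℕ → ℝ), 2 ≤ x → (∀ n, |coef n| ≤ 1) →
      (∀ n, ¬ Squarefree n → coef n = 0) →
      ∑ m ∈ Finset.Ico 1 ⌈x ^ (1 - 4 * ε)⌉₊,
        |∑ n ∈ (Finset.Ico 1 ⌈x ^ (1 / 15 - ε)⌉₊).filter (fun n : ℕ => n.Coprime m),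
          coef n * (((((Finset.Icc 1 ⌊x⌋₊).filter fun t : ℕ =>
              ((m * n : ℕ) : ℤ) ∣ (Iwaniec1978.quadPoly a b c).eval (t : ℤ)).card : ℕ) : ℝ) -
            (polyRootCountMod ![Iwaniec1978.quadPoly a b c] (m * n) : ℝ) * x /
              ((m * n : ℕ) : ℝ))| ≤ K * x ^ (1 - ε) := by
  obtain ⟨C, hC⟩ := h ε hε
  refine ⟨C, fun x coef hx h1 h2 => ?_⟩
  have hsum : ∀ m : ℕ, ∑ n ∈ (Finset.Ico 1 ⌈x ^ (1 / 15 - ε)⌉₊).filter (fun n : ℕ => n.Coprime m),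
      coef n * (((((Finset.Icc 1 ⌊x⌋₊).filter fun t : ℕ =>
          ((m * n : ℕ) : ℤ) ∣ (Iwaniec1978.quadPoly a b c).eval (t : ℤ)).card : ℕ) : ℝ) -
        (polyRootCountMod ![Iwaniec1978.quadPoly a b c] (m * n) : ℝ) * x / ((m * n : ℕ) : ℝ)) =
      Iwaniec1978.bilinearBG a b c x coef m (x ^ (1 / 15 - ε)) := by
    intro m
    unfold Iwaniec1978.bilinearBG Iwaniec1978.remG Iwaniec1978.rhoG
    refine Finset.sum_congr rfl fun n _ => ?_
    rw [card_filter_dvd_eval_quadPoly_eq_congrCountG]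
  simp_rw [hsum]
  exact hC x coef hx h1 h2

/-- **Teräväinen 2024, Proposition 2.11 (quadratic clause) follows from Iwaniec's Corollary of
Proposition 1 for quadratics irreducible over `ℚ`** — the statement the tree calls
`Iwaniec1978.proposition1G_corollary a b c` (level of distribution `x^{16/15}` in bilinear form
for `𝒜_G`, `G = aX² + bX + c`; PROVED in the tree for `(a, b, c) = (1, 0, 1)` only,
`proposition1G_corollary_one_zero_one_iff` + `proposition1_corollary_holds`; for general `G` it
is also the missing input of `Iwaniec1978.theorem_quadratic`).  This is the sharpest form of
"what remains": `teravainen2024_prop_2_11_quadratic ⇐ ∀ a > 0, ∀ b c, G irreducible over ℚ →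
proposition1G_corollary a b c`. [cite: Teravainen2024, Proposition 2.11 and §7] -/
theorem teravainen2024_prop_2_11_quadratic_of_proposition1G_corollary
    (H : ∀ a b c : ℤ, 0 < a →
      Irreducible ((Iwaniec1978.quadPoly a b c).map (Int.castRingHom ℚ)) →
      Iwaniec1978.proposition1G_corollary a b c) :
    teravainen2024_prop_2_11_quadratic := by
  refine teravainen2024_prop_2_11_quadratic_of_level ⟨1 / 15, by norm_num, ?_⟩
  intro G hdeg hlc hirr ε hε
  have hG := eq_quadPoly_of_natDegree_eq_two hdeg
  have ha : 0 < G.coeff 2 := by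
    have : G.leadingCoeff = G.coeff 2 := by rw [Polynomial.leadingCoeff, hdeg]
    rw [← this]; exact hlc
  have hirr' : Irreducible ((Iwaniec1978.quadPoly (G.coeff 2) (G.coeff 1) (G.coeff 0)).map
      (Int.castRingHom ℚ)) := by rw [← hG]; exact hirr
  have h := level_of_proposition1G_corollary (H _ _ _ ha hirr') ε hε
  rw [← hG] at h
  exact h

end PropertyS

end Literature.NumberTheory.Sieve

end
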